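import Mathlib.Analysis.SpecialFunctions.Pow.Real
import Mathlib.Analysis.SpecialFunctions.Pow.Asymptotics
import Literature.Probability.LatticeModels.Sweep1
import HarnessLib

/-!
# Barrier (CriticalPhenomena / Ising3DConformalLimit): ON `ℤ³` ITSELF there are reflection-positive
# ferromagnetic Ising models with Gaussian critical scaling limits (Panis 2023) — non-triviality of
# the nearest-neighbour model cannot come from an interaction-uniform argument

Barrier catalogue `Literature/Barriers/CriticalPhenomena/` (D-0021), sub-problem
`Ising3DConformalLimit` (`Literature.Probability.LatticeModels.CritIsing3DConformalLimit`), clause (iii) (non-Gaussian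
limit, `U₄ ≢ 0`). Companion of `IsingTrivialityFromDimensionFour.lean` (the dimension-uniform
obstruction): here the contrary models live on `ℤ³`.

## What the source prints (Panis, *Triviality of the scaling limits of critical Ising and `φ⁴`
## models with effective dimension at least four*, arXiv:2309.05797 = Ann. Probab. 54 (2026))

* §1.1: Aizenman and Fröhlich "proved that any field obtained as a scaling limit of critical Ising
  or `φ⁴` models in dimension `d ≥ 5` is Gaussian"; the tree diagram bound plus reflection
  positivity: "these methods are robust and extend to more general (in particular long-range)
  reflection positive interactions"; long-range couplings `1/r^{d+α}` change the upper critical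
  dimension to `d_c(α) = min(2α, 4)`, "suggesting that the effective dimension of the model should
  be given by `d_eff(α) = d/(1 ∧ (α/2))`"; "[AF] … lead to the observation that some Ising models
  in dimension `1 ≤ d ≤ 3` present trivial scaling limits at criticality, which is not expected in
  the case of nearest-neighbour interactions" with the footnote "non-triviality of the
  nearest-neighbour Ising model has been proven for `d = 2` in [A], while the case `d = 3` remains
  open. … the recent conformal bootstrap approach … strongly supports this conjecture"; "we prove
  triviality of the scaling limits of one, two, and three dimensional reflection positive Ising
  models with effective dimension four … choosing `α = d/2`".
* §1.2.1: the model `H_{Λ,J,h}(σ) = -Σ_{{x,y}⊂Λ} J_{x,y}σ_xσ_y - hΣσ_x`, `⟨·⟩_{Λ,J,h,β}`, assumptions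
  (A1)–(A5) with the examples nearest-neighbour, Yukawa and `J_{x,y} = C|x-y|₁^{-d-α}`; infinite
  volume by weak limits (Griffiths); `m*(β) = lim_{h→0⁺}⟨σ₀⟩_{β,h}`,
  `β_c = inf{β > 0 : m*(β) > 0} ∈ (0,∞)` (`β_c ≥ |J|⁻¹` [Fisher 1967], Peierls);
  `T_{f,L,β}(σ) = Σ_L(β)^{-1/2} Σ_x f(x/L)σ_x`, `Σ_L(β) = Σ_{x,y∈Λ_L}⟨σ_xσ_y⟩_β`,
  `Λ_L = [-L,L]^d ∩ ℤ^d`; footnote: `0 < c_f ≤ ⟨T_{f,L,β}²⟩_β ≤ C_f < ∞`; Definition 1.1 (scaling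
  limit in distribution); **Theorem 1.2** (vendored below; `d - 2(α∧2) > 0`, i.e. `α < 3/2` on
  `ℤ³`): the Gaussian bound `… ≤ exp((z²/2)⟨T²_{|f|,L,β}⟩) C(β⁻⁴∨β⁻²)‖f‖⁴_∞ r_f^γ z⁴/L^{d-2(α∧2)}`
  for all `β ≤ β_c`, `L ≥ 1`, `f ∈ C_0(ℝ^d)`, `z ∈ ℝ`, "As a consequence, for `β ≤ β_c`, every
  sub-sequential scaling limit … is Gaussian"; Theorem 1.9 and **Corollary 1.11** (`1 ≤ d ≤ 3`,
  `α = d/2`: `g_σ(β) → 0`, Gaussian at `β_c`).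

## What is formalised (namespace `Literature.Barriers.CriticalPhenomena`, model glue in `.LongRangeIsing`)

* `LongRangeIsing.pairHamiltonian / pairGibbsWeight / expectIn / state / magnetization / criticalBeta /
  blockVariance / smeared / mgfDeviation` — the finite-volume free-boundary Gibbs expectation of a
  general pair interaction `J` on `ℤ^d`, its box limit (`limUnder`), `m*`, `β_c`, and Panis's
  `Σ_L(β)`, `T_{f,L,β}`; `algebraicCoupling d C₀ α` (`C₀|x-y|₁^{-d-α}`), `nnCoupling d`. The tree's
  `Literature.Probability.LatticeModels.isingMeasure`/`plusExpect` are unit nearest-neighbour couplings on a graph, so the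
  weighted long-range Hamiltonian is written out here (with the tree's `glue`, `spinAt`, `box`,
  `siteVec`).
* Named facts: `panis_thm12` (Theorem 1.2, constant's `f`-dependence absorbed),
  `panis_variance_bound` (the footnote, upper bound at `β_c`), `panis_criticalBeta_pos`
  (`β_c > 0`, `d ≥ 2`).
* `HasNonGaussianSmearingZ3 J` (target shape), the family `Z3Model` (nearest-neighbour and the
  algebraically decaying models on `ℤ³`) with `Z3Model.coupling`, the technique class
  `InteractionUniformZ3 Φ := ∀ m, Φ m`, and the barrier `LongRangeTrivialityOnZ3 : ∀ C₀ α,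
  0 < C₀ → 0 < α → α < 3/2 → ¬ HasNonGaussianSmearingZ3 (algebraicCoupling 3 C₀ α)`, PROVED from
  the three facts (`of_facts`), with `not_interactionUniformZ3`, `alpha_ge_of_hasNonGaussianSmearing`,
  `nn_or_alpha_ge`.

## References

* R. Panis, arXiv:2309.05797 (2023), Ann. Probab. 54 (2026), §1.1, §1.2.1, Def. 1.1, Thm 1.2,
  Thm 1.9, Cor. 1.11 [Panis2023Triviality] (held, read).
* M. Aizenman, R. Fernández, Lett. Math. Phys. 16 (1988) 39 ([AF] of the source; not consulted).
* M. Aizenman, H. Duminil-Copin, Ann. Math. 194 (2021) [AizenmanDuminilCopinAnnals2021];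
  H. Duminil-Copin, Proc. ICM 2022, §6.4 [DuminilCopinICM2022].
-/

noncomputable section

namespace Literature.Barriers.CriticalPhenomena

open Literature.Probability.LatticeModels Literature.Probability.Percolation Filter Topology Finset

/-! ### Ferromagnetic pair interactions on `ℤ^d`: finite-volume Gibbs states, the infinite-volume
state, `β_c`, smeared averages (Panis 2023, §1.2.1) -/

namespace LongRangeIsing

variable {d : ℕ}

/-- The `ℓ¹` norm `|x|₁ = Σᵢ |xᵢ|` of a lattice vector. [cite: Panis2023Triviality, §1.2.1 (footnote: |.|₁ the ℓ¹ norm)] -/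
def l1Norm (x : Site d) : ℕ := ∑ i, (x i).natAbs

/-- The finite-volume Hamiltonian with free boundary condition and field `h`,
`H_{Λ,J,h}(σ) = -Σ_{{x,y} ⊂ Λ} J_{x,y} σ_x σ_y - h Σ_{x ∈ Λ} σ_x` (the sum over unordered pairs
written as half the ordered double sum; intended for symmetric `J` with `J_{x,x} = 0`).
[cite: Panis2023Triviality, §1.2.1 (H_{Λ,J,h})] -/
def pairHamiltonian (J : Site d → Site d → ℝ) (Λ : Finset (Site d)) (h : ℝ) (σ : SpinConfig (Site d)) : ℝ :=
  -(∑ x ∈ Λ, ∑ y ∈ Λ, J x y * spinAt x σ * spinAt y σ) / 2 - h * ∑ x ∈ Λ, spinAt x σ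

/-- The Gibbs weight `exp[-β H_{Λ,J,h}(σ)]` of a configuration `τ` on `Λ` (free boundary
condition: `glue Λ τ free`; spins outside `Λ` are not read). [cite: Panis2023Triviality, §1.2.1 (⟨·⟩_{Λ,J,h,β})] -/
def pairGibbsWeight (J : Site d → Site d → ℝ) (Λ : Finset (Site d)) (β h : ℝ) (τ : Λ → ℤˣ) : ℝ :=
  Real.exp (-β * pairHamiltonian J Λ h (glue Λ τ .free))

/-- The finite-volume Gibbs expectation
`⟨F⟩_{Λ,J,h,β} = Z(Λ,J,h,β)⁻¹ Σ_{σ ∈ {±1}^Λ} F(σ) exp[-β H_{Λ,J,h}(σ)]`.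
[cite: Panis2023Triviality, §1.2.1 (⟨F⟩_{Λ,J,h,β}, Z(Λ,J,h,β))] -/
def expectIn (J : Site d → Site d → ℝ) (Λ : Finset (Site d)) (β h : ℝ) (F : SpinConfig (Site d) → ℝ) : ℝ :=
  (∑ τ : Λ → ℤˣ, F (glue Λ τ .free) * pairGibbsWeight J Λ β h τ) / ∑ τ : Λ → ℤˣ, pairGibbsWeight J Λ β h τ

/-- The infinite-volume Gibbs state `⟨F⟩_{J,h,β} := lim_{L → ∞} ⟨F⟩_{Λ_L,J,h,β}` along the boxes
`Λ_L = [-L,L]^d ∩ ℤ^d` ("Using Griffiths' inequalities, one can obtain the associated infinite volume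
Gibbs measure by taking weak limits of `⟨·⟩_{Λ,J,h,β}` as `Λ ↗ ℤ^d`"). By `limUnder`: the limit
exists for local `F` when `J ≥ 0`, `β, h ≥ 0`; **junk-valued** otherwise.
[cite: Panis2023Triviality, §1.2.1 (infinite volume Gibbs measure ⟨·⟩_{J,h,β})] -/
def state (J : Site d → Site d → ℝ) (β h : ℝ) (F : SpinConfig (Site d) → ℝ) : ℝ :=
  limUnder atTop fun L : ℕ => expectIn J (box d L) β h F

/-- The spontaneous magnetisation `m*(β) := lim_{h → 0⁺} ⟨σ₀⟩_{β,h}` (by `limUnder`).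
[cite: Panis2023Triviality, §1.2.1 (m*(β))] -/
def magnetization (J : Site d → Site d → ℝ) (β : ℝ) : ℝ :=
  limUnder (𝓝[>] (0 : ℝ)) fun h => state J β h (spinAt 0)

/-- The critical inverse temperature `β_c := inf {β > 0 | m*(β) > 0}` (`sInf ∅ = 0` if there is no
transition). [cite: Panis2023Triviality, §1.2.1 (β_c)] -/
def criticalBeta (J : Site d → Site d → ℝ) : ℝ :=
  sInf {β : ℝ | 0 < β ∧ 0 < magnetization J β}

/-- `Σ_L(β) := ⟨(Σ_{x ∈ Λ_L} σ_x)²⟩_β` at zero field. [cite: Panis2023Triviality, §1.2.1 (Σ_L(β))] -/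
def blockVariance (J : Site d → Site d → ℝ) (β : ℝ) (L : ℕ) : ℝ :=
  state J β 0 fun σ => (∑ x ∈ box d L, spinAt x σ) ^ 2

/-- The smeared observable `T_{f,L,β}(σ) := Σ_L(β)^{-1/2} Σ_{x ∈ ℤ^d} f(x/L) σ_x`
(`finsum`, the printed finite sum for compactly supported `f`).
[cite: Panis2023Triviality, §1.2.1 (T_{f,L,β})] -/
def smeared (J : Site d → Site d → ℝ) (β : ℝ) (L : ℕ) (f : EuclideanSpace ℝ (Fin d) → ℝ)
    (σ : SpinConfig (Site d)) : ℝ :=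
  (∑ᶠ x : Site d, f ((L : ℝ)⁻¹ • siteVec x) * spinAt x σ) / Real.sqrt (blockVariance J β L)

/-- The deviation from Gaussianity of the moment generating function,
`|⟨exp(z T_{f,L,β})⟩_β - exp((z²/2) ⟨T_{f,L,β}²⟩_β)|`. [cite: Panis2023Triviality, Theorem 1.2 (left-hand side)] -/
def mgfDeviation (J : Site d → Site d → ℝ) (β : ℝ) (L : ℕ) (f : EuclideanSpace ℝ (Fin d) → ℝ) (z : ℝ) : ℝ :=
  |state J β 0 (fun σ => Real.exp (z * smeared J β L f σ)) -
    Real.exp (z ^ 2 / 2 * state J β 0 fun σ => smeared J β L f σ ^ 2)|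

/-- Panis's algebraically decaying (reflection-positive) interaction
`J_{x,y} = C₀ |x - y|₁^{-d-α}` for `x ≠ y` (and `J_{x,x} = 0`).
[cite: Panis2023Triviality, §1.2.1 (examples (A1)–(A5): algebraic decay) and Theorem 1.2] -/
def algebraicCoupling (d : ℕ) (C₀ α : ℝ) (x y : Site d) : ℝ :=
  if x = y then 0 else C₀ * (l1Norm (x - y) : ℝ) ^ (-((d : ℝ) + α))

/-- The nearest-neighbour coupling `J_{x,y} = 𝟙{|x - y|₁ = 1}`.
[cite: Panis2023Triviality, §1.2.1 (examples: nearest-neighbour interactions)] -/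
def nnCoupling (d : ℕ) (x y : Site d) : ℝ := if l1Norm (x - y) = 1 then 1 else 0

end LongRangeIsing

open LongRangeIsing

/-! ### The printed theorems (named facts), `d` general -/

/-- NAMED FACT — **Panis 2023, Theorem 1.2 (effective dimension `> 4`: Gaussian bound).** "Let
`d ≥ 1`. Let `J` be the interaction defined for `x ≠ y ∈ ℤ^d` by `J_{x,y} = C₀|x-y|₁^{-d-α}` where
`C₀, α > 0`. We also assume that `d - 2(α ∧ 2) > 0`. There exists `C = C(C₀,d), γ = γ(d) > 0` such
that for all `β ≤ β_c`, `L ≥ 1`, `f ∈ C_0(ℝ^d)` and `z ∈ ℝ`,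
`|⟨exp(z T_{f,L,β}(σ))⟩_β - exp((z²/2)⟨T_{f,L,β}(σ)²⟩_β)| ≤
exp((z²/2)⟨T_{|f|,L,β}(σ)²⟩_β) · C (β⁻⁴ ∨ β⁻²) ‖f‖_∞⁴ r_f^γ z⁴ / L^{d-2(α∧2)}`. As a consequence,
for `β ≤ β_c`, every sub-sequential scaling limit … of the model is Gaussian." Vendored with the
`f`-dependence of the constant absorbed (`C_f` in place of `C ‖f‖_∞⁴ r_f^γ` — weaker than printed)
and for `0 < β ≤ β_c`. Users take `(h : panis_thm12)`. [cite: Panis2023Triviality, Theorem 1.2] -/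
def panis_thm12 : Prop :=
  ∀ (d : ℕ), 1 ≤ d → ∀ (C₀ α : ℝ), 0 < C₀ → 0 < α → 0 < (d : ℝ) - 2 * min α 2 →
    ∀ (f : EuclideanSpace ℝ (Fin d) → ℝ), Continuous f → HasCompactSupport f →
      ∃ C : ℝ, 0 < C ∧ ∀ (β : ℝ), 0 < β → β ≤ LongRangeIsing.criticalBeta (algebraicCoupling d C₀ α) →
        ∀ (L : ℕ), 1 ≤ L → ∀ (z : ℝ),
          mgfDeviation (algebraicCoupling d C₀ α) β L f z ≤
            Real.exp (z ^ 2 / 2 * state (algebraicCoupling d C₀ α) β 0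
                (fun σ => smeared (algebraicCoupling d C₀ α) β L (fun x => |f x|) σ ^ 2)) *
              (C * max (β ^ (-(4 : ℝ))) (β ^ (-(2 : ℝ))) * z ^ 4 / (L : ℝ) ^ ((d : ℝ) - 2 * min α 2))

/-- NAMED FACT — **the smeared variances are bounded** (Panis 2023, §1.2.1, footnote to the
definition of `T_{f,L,β}`): "for `f = 𝟙_{[-1,1]^d}`, `⟨T_{f,L,β}(σ)²⟩_β = 1`, and more generally for
`f ≠ 0`, one has `0 < c_f ≤ ⟨T_{f,L,β}(σ)²⟩_β ≤ C_f < ∞` … bounded away from `0` and `∞` by constants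
that only depend on `f`." Vendored (upper bound only, at `β = β_c`, for the algebraically decaying
models of Theorem 1.2) as: for continuous compactly supported `f` there is `C_f` with
`⟨T_{f,L,β_c}²⟩_{β_c} ≤ C_f` for all `L ≥ 1`. Users take `(h : panis_variance_bound)`.
[cite: Panis2023Triviality, §1.2.1 (footnote on ⟨T_{f,L,β}²⟩)] -/
def panis_variance_bound : Prop :=
  ∀ (d : ℕ), 1 ≤ d → ∀ (C₀ α : ℝ), 0 < C₀ → 0 < α →
    ∀ (f : EuclideanSpace ℝ (Fin d) → ℝ), Continuous f → HasCompactSupport f →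
      ∃ Cf : ℝ, ∀ (L : ℕ), 1 ≤ L →
        state (algebraicCoupling d C₀ α) (LongRangeIsing.criticalBeta (algebraicCoupling d C₀ α)) 0
            (fun σ => smeared (algebraicCoupling d C₀ α) (LongRangeIsing.criticalBeta (algebraicCoupling d C₀ α)) L f σ ^ 2)
          ≤ Cf

/-- NAMED FACT — **the algebraically decaying models have a transition, `0 < β_c < ∞`, for `d ≥ 2`**
("The above assumptions guarantee [Fisher 1967] that `β_c > 0` (in fact `β_c ≥ |J|⁻¹`), while
Peierls' celebrated argument yields the bound `β_c < ∞`"; in `d = 1` only for `α ≤ 1`). Only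
`0 < β_c` is used below. Users take `(h : panis_criticalBeta_pos)`.
[cite: Panis2023Triviality, §1.2.1 (β_c ∈ (0,∞))] -/
def panis_criticalBeta_pos : Prop :=
  ∀ (d : ℕ), 2 ≤ d → ∀ (C₀ α : ℝ), 0 < C₀ → 0 < α → 0 < LongRangeIsing.criticalBeta (algebraicCoupling d C₀ α)

/-! ### The barrier on `ℤ³` -/

/-- **Target shape for a pair interaction `J` on `ℤ³` (smeared form of non-triviality):** some
smeared critical average has a non-Gaussian moment generating function asymptotics,
`∃ f ∈ C_c(ℝ³), ∃ z, |⟨exp(z T_{f,L,β_c})⟩_{β_c} - exp((z²/2)⟨T²_{f,L,β_c}⟩_{β_c})| ↛ 0` — the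
negation of the printed Gaussianity conclusion, i.e. clause (iii) (`U₄ ≢ 0`) of the sub-problem in
the smeared form of Panis / Aizenman–Duminil-Copin. [cite: Panis2023Triviality, Definition 1.1 and Theorem 1.2 ("every sub-sequential scaling limit … is Gaussian")] -/
def HasNonGaussianSmearingZ3 (J : Site 3 → Site 3 → ℝ) : Prop :=
  ∃ f : EuclideanSpace ℝ (Fin 3) → ℝ, Continuous f ∧ HasCompactSupport f ∧ ∃ z : ℝ,
    ¬ Tendsto (fun L : ℕ => mgfDeviation J (LongRangeIsing.criticalBeta J) L f z) atTop (𝓝 0)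

/-- **The model family on `ℤ³`** over which "interaction-uniform" is meant: the nearest-neighbour
model (the sub-problem's) and Panis's reflection-positive algebraically decaying models
`J_{x,y} = C₀|x-y|₁^{-3-α}`, `C₀, α > 0` (all satisfy (A1)–(A5): ferromagnetic, locally finite,
translation invariant, irreducible, reflection positive).
[cite: Panis2023Triviality, §1.2.1 (examples satisfying (A1)–(A5))] -/
inductive Z3Model : Type
  /-- the nearest-neighbour ferromagnet `J = 𝟙{|x-y|₁ = 1}` -/
  | nearestNeighbour : Z3Model
  /-- `J_{x,y} = C₀ |x-y|₁^{-3-α}`, `C₀ > 0`, `α > 0` -/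
  | algebraic (C₀ α : ℝ) (hC₀ : 0 < C₀) (hα : 0 < α) : Z3Model

/-- The coupling function of a member of the family. [cite: Panis2023Triviality, §1.2.1] -/
def Z3Model.coupling : Z3Model → Site 3 → Site 3 → ℝ
  | .nearestNeighbour => nnCoupling 3
  | .algebraic C₀ α _ _ => algebraicCoupling 3 C₀ α

/-- **Technique class: interaction-uniform arguments on `ℤ³`.** `Φ` is established
interaction-uniformly if it holds for every member of `Z3Model` — the output of any argument for
the nearest-neighbour model on `ℤ³` whose steps are valid for all reflection-positive ferromagnetic
pair interactions (Griffiths/GHS/Lebowitz/MMS inequalities, the infrared bound and spectral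
representation, random currents: "these methods are robust and extend to more general (in
particular long-range) reflection positive interactions"). Same pattern as `DimensionUniform` in
`IsingTrivialityFromDimensionFour.lean` and `LatticeBlind` in `BootstrapLatticeBlindness.lean`.
[cite: Panis2023Triviality, §1.1 ("these methods are robust and extend to … long-range reflection positive interactions")] -/
def InteractionUniformZ3 (Φ : Z3Model → Prop) : Prop := ∀ m : Z3Model, Φ m

/-- A single member of the family where `Φ` fails excludes every interaction-uniform derivation of
`Φ`. [folklore] -/
theorem not_interactionUniformZ3_of_counterexample {Φ : Z3Model → Prop} (m : Z3Model) (h : ¬ Φ m) :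
    ¬ InteractionUniformZ3 Φ := fun hU => h (hU m)

/-- **Barrier `LongRangeTrivialityOnZ3`.** On `ℤ³`, every reflection-positive model
`J_{x,y} = C₀|x-y|₁^{-3-α}` with `0 < α < 3/2` (effective dimension `d/(1 ∧ α/2) > 4`) has Gaussian
critical smeared scaling limits: `¬ HasNonGaussianSmearingZ3 (algebraicCoupling 3 C₀ α)`. PROVED
below (`LongRangeTrivialityOnZ3.of_facts`) from Panis's Theorem 1.2, the variance footnote and
`β_c > 0`; consequence `not_interactionUniformZ3`: the property "non-Gaussian critical smearing"
is not interaction-uniform on `ℤ³`, so a proof of non-triviality for the nearest-neighbour model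
must use an input that fails for `α < 3/2` ("some Ising models in dimension `1 ≤ d ≤ 3` present
trivial scaling limits at criticality, which is not expected in the case of nearest-neighbour
interactions").

BARRIER (structured block, D-0021):
- technique_class: interaction-uniform methods on `ℤ³` — formally `InteractionUniformZ3 Φ := ∀ m : Z3Model, Φ m` (nearest-neighbour and all `C₀|x-y|₁^{-3-α}`, `C₀, α > 0`): arguments for non-triviality of the critical nearest-neighbour model whose steps hold for every reflection-positive ferromagnetic pair interaction on `ℤ³` — correlation inequalities, reflection positivity/infrared bound/spectral representation, random-current and switching-lemma identities, sharpness — "these methods are robust and extend to more general (in particular long-range) reflection positive interactions" [cite: Panis2023Triviality, §1.1]; AUDIT 2026-08-15, generation 2 (`LongRangeTrivialityOnZ3BubbleAudit.lean`): this class is contained in — and the formal barrier is a corollary of — the sharper BUBBLE-BLIND class of `BubbleTrivialityOnZ3`: arguments every step of which holds for some ferromagnetic translation-invariant pair interaction on `ℤ³` with Messager–Miracle-Solé-monotone critical two-point function and finite critical bubble diagram `B(β_c) = ∑ₓ⟨σ₀σ_x⟩²_{β_c} < ∞`; that such a `J` has Gaussian critical smearings is PROVED (`BubbleTrivialityOnZ3_holds`: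 the `β = β_c`, `L → ∞` form of "the bubble condition … implies triviality of the scaling limits") [cite: Panis2023Triviality, Remark 1.6 (p. 7) and Theorem 12.2 (p. 51)]; AUDIT 2026-08-15, generation 4 (`LongRangeTrivialityOnZ3SusceptibilityAudit.lean`): both classes are contained in the TREE-DIAGRAM-BLIND class of `SusceptibilityTrivialityOnZ3` — arguments every step of which holds for some MMS-monotone ferromagnetic translation-invariant pair interaction on `ℤ³` whose critical box susceptibility `χ_L(β_c) = ∑_{x∈Λ_L}⟨σ₀σ_x⟩_{β_c}` is `o(L^{3/2})` (`χ_L(β_c)²/L³ → 0`; "`η > 1/2`" in lim-sup form); that such a `J` has Gaussian critical smearings is PROVED (`SusceptibilityTrivialityOnZ3_holds`), `B(β_c) < ∞` implies the hypothesis (`LongRangeIsing.tendsto_boxSusceptibility_sq_div_of_summable_sq`), and the hypothesis is the EXACT reach of the tree-diagram mechanism: with finite tree diagrams `χ_L²/L³ ≤ 3⁹R⁹𝒮_T(β,L,R)` (`LongRangeIsing.boxSusceptibility_sq_div_le_treeFourBoxSum`), so `𝒮_T → 0` iff `χ_L²/L³ → 0` [cite: Panis2023Triviality, Remark 1.6 (p.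 7), proof of Theorem 5.5 (pp. 21–22) and Theorem 12.2 (p. 51)]; AUDIT 2026-08-15, generation 7 (`LongRangeTrivialityOnZ3PerturbativeAudit.lean`): at the level of the INTERACTION the blocked class is wider than the extensional `InteractionUniformZ3` — the contrary models ACCUMULATE AT `J_nn`: every heavy-tailed perturbation `J_nn + ε|x-y|₁^{-3-α}` (`ε > 0`, `0 < α < 3/2`) satisfies (A1)–(A5) (positive combinations of the listed reflection-positive couplings are reflection positive) with algebraic slices `∑_{|x|=k}J_{0,x} ≍ k^{-1-α}`, hence has Gaussian critical smearings by the general form of Theorem 1.2 (`PerturbativeTrivialityOnZ3`, PROVED: `PerturbativeTrivialityOnZ3_holds` in `LongRangeTrivialityOnZ3PerturbativeAuditProofs.lean`, with a second run of the route in `LongRangeTrivialityOnZ3PerturbativeHolds.lean` — the torus route of `panis_infraredBound_algebraic_holds` run for the periodised SUM coupling, the nearest-neighbour part being reflection positive with a diagonal crossing kernel, feeding `PerturbativeTrivialityOnZ3.of_irb` and `BubbleTrivialityOnZ3_holds`); consequently every argument containing a step that is upward-MONOTONE in the coupling from `J_nn` (Griffiths-type comparisons "`J ≥ J_nn` ⟹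 …"; `PerturbativeTrivialityOnZ3.no_monotone_route`) or that survives all small such perturbations — in particular every `ℓ¹_s`-OPEN condition at `J_nn` within reflection-positive ferromagnets, `s < 3/2` (`PerturbativeTrivialityOnZ3.no_open_route`, `.exists_gaussian_near_nn`: `J_nn` is in the `ℓ¹_s`-closure of the Gaussian domain for every `s < 3/2`, uniformly and from above) — is blocked [cite: Panis2023Triviality, Theorem 5.5 and Remark 5.4 (p. 21), §3.1 (p. 13)] [cite: AizenmanFernandez1988, Abstract and §3 (p. 45)]; AUDIT 2026-08-16, generation 15 (`LongRangeTrivialityOnZ3IsotropyAudit.lean`): the class constrains no SYMMETRY input — full `O(3)`/Möbius covariance of the scaling limit (clause (ii)) fails for every contrary model (anisotropic `ℓ¹` kernels), so '(ii) ⟹ (iii)'-shaped arguments are outside its demonstrated reach; see scope_caveats (p) for the isotropic Gaussian lattice models (spread-out, [cite: ChenSakai2015, Theorem 1.2]) that take over that role; AUDIT 2026-08-17, generation 23 (`LongRangeTrivialityOnZ3DiagonalRPAudit.lean`): 'reflection positive' here and in (A5) of the source means the three COORDINATE mirror families (through sites and mid-edges) [cite: Panis2023Triviality, Definition 3.1 (§3.1),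 p. 13]; reflection positivity through the six DIAGONAL site-mirror families `{xᵢ = ±xⱼ + c}`, which `J_nn` has [cite: Biskup2009, §5.4 (Diagonal reflections)] and NO other member of `Z3Model` has (`Z3Model.diagonalCrossingPSD_iff`, `not_interactionUniformZ3_diagonalCrossingPSD`), is outside the extensional class — see scope_caveats (q) for what that gap does and does not permit; AUDIT 2026-08-17, generation 24 (`LongRangeTrivialityOnZ3ThermalAudit.lean`): the class constrains no THERMAL-sector input either — the susceptibility exponent `γ`, the specific heat, the energy operator / adjacent avoidance of sourced random currents (`Δ_ε > 2Δ_σ ⟺ γ > 1`; the planners' `EnergyGapPowerLaw`) — all contrary members being mean-field there in print [cite: AizenmanFernandez1988, Abstract and Proposition 2.1 (c), pp. 39, 43]; see scope_caveats (r); AUDIT 2026-08-17, generation 26 (`LongRangeTrivialityOnZ3ProofsAudit.lean` §K): nor any SURFACE / BOUNDARY-CONDITION-sector input — coercivity or shape-growth at `β_c` of the Duminil-Copin–Tassion sharpness functional `φ_{β_c}(S)`, free-wall exponents and half-space responses, wired-vs-free sensitivity of critical block observables, annulus non-crossing — the `α < 1` members having `1 ≤ φ_{β_c}(Λ_n) ≤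 C` uniformly in `n` [cite: DuminilCopinTassionCMP2016, §2.1–§2.2] and every member crossing every annulus by a single long FK edge; see scope_caveats (s); AUDIT 2026-08-17, generation 30 (`LongRangeTrivialityOnZ3MonotoneBlockingAudit.lean`): nor any BLOCKING-ORBIT monotonicity input — monotonicity in the block side `L` of the normalisation-free block covariances `ρ(L;k) = ⟨S_L(0)S_L(Lk)⟩/⟨S_L²⟩` (route `Theses/MonotoneBlocking.lean`, `MonotoneBlockingTwo` / `MonotoneBlockingMoments`) fails at the Gaussian rung of every member computed, `1/4 ≤ α ≤ 1.4` (exact lattice Green functions of the `J`-walks; `ρ(1;2e₁) = 0.02153 > ρ(2;2e₁) = 0.01787` at `α = 1/2`; at `α = 1.4` the body-diagonal block covariances turn down at `L = 7–9`), and is predicted to fail for all `α < 3/2`, while `ρ ∈ [0,1]` and the growth of the per-site block variance are theorems for every ferromagnet; an existence lever, not engaged for (iii); see scope_caveats (v)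
- blocks: the strengthening of clause (iii) of `Ising3DConformalLimit` (`Literature.Probability.LatticeModels.CritIsing3DConformalLimit`; smeared form `HasNonGaussianSmearingZ3`) from the nearest-neighbour model to all reflection-positive ferromagnets on `ℤ³`: refuted at `α = 1` (`LongRangeTrivialityOnZ3.not_interactionUniformZ3`), and quantitatively every `α < 3/2` is excluded (`LongRangeTrivialityOnZ3`, `alpha_ge_of_hasNonGaussianSmearing`); complements the dimension-uniform barrier `IsingTrivialityFromDimensionFour` by an obstruction living on `ℤ³`
- because: long-range couplings raise the effective dimension, `d_eff(α) = d/(1 ∧ (α/2))` [cite: Panis2023Triviality, §1.1 (Fisher–Ma–Nickel; d_c(α) = min(2α,4))]; for `d - 2(α ∧ 2) > 0` the infrared bound for `J` gives a two-point decay fast enough that Aizenman's tree diagram bound `|U₄| ≤ 2Σ_u Π⟨σ_uσ_{x_j}⟩` already forces the Gaussian bound `O(L^{-(d-2(α∧2))})` on the moment generating functions [cite: Panis2023Triviality, §1.1 and Theorem 1.2]; at `d_eff = 4` (`α = 3/2` on `ℤ³`) an improved tree diagram bound with a divergent bubble factor gives `g_σ(β) → 0` and Gaussianity [cite: Panis2023Triviality,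 Theorem 1.9 and Corollary 1.11]; earlier: Aizenman–Fernández observed trivial scaling limits for such models in `1 ≤ d ≤ 3` [cite: Panis2023Triviality, §1.1 ([AF])]
- evasions_known: none published for the nearest-neighbour model: "non-triviality of the nearest-neighbour Ising model has been proven for `d = 2` in [A], while the case `d = 3` remains open", with conformal-bootstrap numerics supporting the conjecture [cite: Panis2023Triviality, §1.1 (footnote)]; the expected dichotomy for fast-decaying interactions (nearest-neighbour universality class vs logarithmic corrections exactly at the boundary) is a prediction [cite: Panis2023Triviality, §1.1 ("The prediction is that only two situations may occur")]; AUDIT 2026-08-15 (`LongRangeTrivialityOnZ3ProofsAudit.lean`): nearest-neighbour-SPECIFIC outputs of the reflection-positivity/random-current toolbox do exist on `ℤ³` at the two-point level — "Theorem 1.8 (Divergence of the bubble diagram). Let `d = 3, 4`. Then `B(β_c) = ∞`" and "Theorem 1.5. Let `d = 3`. If the critical exponent `η` exists, it satisfies `η ≤ 1/2`" for the nearest-neighbour model, by the switching lemma applied to a reflected current, the infrared and MMS bounds, the spectral representation and the sharp length [cite: DuminilCopinPanis2025LowerBounds, Theorems 1.2, 1.5 and 1.8] — whereas `B(β_c)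 < ∞` for every `α < 3/2` member of `Z3Model` (`LongRangeIsing.summable_sq_pairCorrelation_criticalBeta`, from the infrared bound of the tree), so "`B(β_c) = ∞`" is not interaction-uniform (`not_interactionUniformZ3_bubble_divergence`); no such nearest-neighbour-specific output is known at the level of `U₄` / non-Gaussianity, where the interaction-uniform identity `U₄ = -2⟨σ_{x₁}σ_{x₂}⟩⟨σ_{x₃}σ_{x₄}⟩·P[{x₁,x₂} ⟷ {x₃,x₄}]` [cite: AizenmanCDM2020, Theorem 5.4, eq. (5.13)] reduces the question to intersection properties of currents ("the range of an `α`-stable process has dimension `α` … two independent processes generically do not intersect in dimensions above `2α`" [cite: Slade2017, §1.1]; the case `d = 3` is omitted "not by chance" [cite: AizenmanCDM2020, §5.3 and §11]); AUDIT 2026-08-15, generation 2: the two-point-level output `B(β_c) = ∞` is exactly what takes the nearest-neighbour model OUT of the sharpened bubble-blind class — MMS granted, a non-Gaussian critical smearing of any member of `Z3Model` implies `B(β_c) = ∞` (`hasNonGaussianSmearingZ3_member_imp`, `LongRangeTrivialityOnZ3BubbleAudit.lean`), and within Panis's family this holds for EVERY `α > 0` (`not_summable_sq_of_hasNonGaussianSmearingZ3_algebraic`)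 — so a nearest-neighbour proof must consume the divergence of the bubble or an input implying it, which is available [cite: DuminilCopinPanis2025LowerBounds, Theorem 1.8]; it is NOT sufficient: the nearest-neighbour model on `ℤ⁴` has `B(β_c) = ∞` [cite: DuminilCopinPanis2025LowerBounds, Theorem 1.8] and Gaussian critical scaling limits [cite: AizenmanDuminilCopinAnnals2021, Theorem 1.2], the marginal member `α = 3/2` is Gaussian whether or not its bubble diverges ("if `B(β_c) = ∞`, one obtains the result taking `L` to infinity. If `B(β_c) < ∞`, we may conclude using Theorem 12.2") [cite: Panis2023Triviality, Corollary 1.11 (p. 8) and §7.5 (p. 41)], and the established nearest-neighbour bubble growth on `ℤ³` is `B_n(β_c) ≥ c√(log n)` only [cite: DuminilCopinPanis2025LowerBounds, Remark 1.9]; the missing piece is a `d = 3` mechanism turning bubble growth into `U₄ ≢ 0` (for long-range PERCOLATION of low effective dimension the analogous non-triviality of the critical `k`-point functions is proved conditionally [cite: Hutchcroft2025, Theorem II.1.11]); AUDIT 2026-08-15, generation 3: no escape through the pointwise clause (iii) or the choice of renormalisation either — for any member of `Z3Model` with MMS-monotone critical two-point function (the nearest-neighbour one included, granted MMS2 for it),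 a pointwise scaling limit of the critical correlators with `U₄ ≢ 0` forces `B(β_c) = ∞` (`hasNontrivialU4_member_imp`, `LongRangeTrivialityOnZ3PointwiseAudit.lean`), so a nearest-neighbour proof of clause (iii) must consume the divergence of the bubble (or an input implying it) at the pointwise level too [cite: Panis2023Triviality, Theorem 12.2 (p. 51)]; AUDIT 2026-08-15, generation 4 (`LongRangeTrivialityOnZ3SusceptibilityAudit.lean`): the divergence of the bubble is necessary but is NOT what takes the nearest-neighbour model out of the reach of the tree-diagram mechanism — `B(β_c) = ∞` with `B_n(β_c) ≥ c√(log n)` is compatible with `χ_L(β_c) = o(L^{3/2})` (a two-point function `⟨σ₀σ_x⟩ ≍ |x|^{-3/2}(log|x|)^{-1/4}` has both), i.e. with membership in the sharpened class `SusceptibilityTrivialityOnZ3`; the sharp necessary condition is `limsup_L χ_L(β_c)/L^{3/2} > 0` — a non-Gaussian critical smearing of any MMS-monotone member of `Z3Model` forces `χ_L(β_c)² ≥ cL³` for some `c > 0` and infinitely many `L` (`hasNonGaussianSmearingZ3_member_imp_frequently`) — and the nearest-neighbour model on `ℤ³` satisfies it, by the reflected-current LOWER bound "Theorem 1.3. Let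 `d ≥ 3`. … for all `β ≤ β_c` and for all `N₁ ≤ n ≤ L(β)`, `⟨τ₀τ_{ne₁}⟩_β ≥ c₁/(χ_{4n}(β) + n^{d-2}∑_{1≤k≤2n}k⟨τ₀τ_{ke₁}⟩_β)`" at `β_c` (`L(β_c) = ∞`) combined with the MMS inequalities: if `χ_n(β_c) ≤ εn^{3/2}` eventually then `∑_{k≤2n}k⟨τ₀τ_{ke₁}⟩ ≤ A + Cε√n`, `⟨τ₀τ_x⟩_{β_c} ≥ c/(ε|x|₁^{3/2})` and `χ_n(β_c) ≥ (c′/ε)n^{3/2}`, a contradiction for `ε² < c′` (paper derivation in that file; the printed conditional form is "Theorem 1.5. Let `d = 3`. If the critical exponent `η` exists, it satisfies `η ≤ 1/2`") [cite: DuminilCopinPanis2025LowerBounds, Theorems 1.3 and 1.5]; so the two-point input a nearest-neighbour proof must consume exists at exactly the required strength, and the missing piece is unchanged — a lower bound on `|U₄|` of the order of the tree diagram (a uniformly positive intersection probability of two critical current clusters with distant sources) [cite: AizenmanCDM2020, Lemma 8.1 eq. (8.1) (p. 25) and §11 (p. 35)]; AUDIT 2026-08-15, generation 7 (`LongRangeTrivialityOnZ3PerturbativeAudit.lean`):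 whatever the route, the nearest-neighbour input must be DISCONTINUOUS at `ε = 0` along `J_nn + ε|x-y|₁^{-3-α}` (`α < 3/2`); the Hamiltonian-level separator is the LIGHT TAIL of the coupling — `𝔪_{3/2}(J) = ∑_y‖y‖^{3/2}J_{0,y} = ∞` for every contrary model of this barrier (pure or perturbed, `α < 3/2`) while `𝔪_s(J_nn) < ∞` for all `s` (`moment_threeHalves_dichotomy`, unconditional), exactly as Panis's `d = 4` analysis is organised by `𝔪₂(J)` (Theorem 1.3 when `𝔪₂(J) = ∞`; (A6), the improved tree diagram bound and the lower bound `⟨τ₀τ_x⟩ ≥ c/(β|x|^{d-1})` of Proposition 3.23 when `𝔪₂(J) < ∞`) [cite: Panis2023Triviality, Theorem 1.3, (A6), Theorem 1.5 (p. 7) and Proposition 3.23 (p. 16)]; qualifying inputs: finite range / the Markov property (generation 5's locality route; the reflected currents behind Theorems 1.2–1.3 of Duminil-Copin–Panis) [cite: DuminilCopinPanis2025LowerBounds, Theorems 1.2 and 1.3]; non-qualifying: Griffiths-monotone comparisons `J ≥ J_nn`, convergent expansions in a long-range perturbation, continuity of `β_c(J)` or of finitely many local critical observables in `J`; AUDIT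 2026-08-15, generation 8 (`LongRangeTrivialityOnZ3MarginalAudit.lean`): "exists at exactly the required strength" (generation 4) holds against the PLAIN tree-diagram bound only — against the IMPROVED tree diagram bound (the `d_eff = 4` mechanism: `|U₄|/S₄ ≤ C/L^{d-4+2η}` has exponent `0` at `η = 1/2` on `ℤ³` [cite: AizenmanCDM2020, §10.1 eq. (10.2), p. 31]; Gaussianity is PROVED for the member `α = 3/2` and expected by its author "under more general assumptions" [cite: Panis2023Triviality, §7 (Theorem 7.1, footnote 7, Corollary 7.3), p. 34]) the required nearest-neighbour two-point input is the STRICT `η < 1/2` (`limsup_x |x|^{3/2}⟨σ₀σ_x⟩_{β_c} = ∞`; window form with `ε > 0`), which does NOT exist in print: the marginal profile `⟨σ₀σ_x⟩_{β_c} ≍ |x|^{-3/2}` (`χ_n ≍ n^{3/2}`, `B_n ≍ log n`) saturates the infrared bound, Simon's bound and Theorems 1.3, 1.5, 1.8 / Remark 1.9 of Duminil-Copin–Panis (`LongRangeIsing.marginalProfile_of_dcp`, `LongRangeIsing.bubble_le_log_of_marginalDecay`: Theorem 1.3 returns the two-sided marginal profile, the bubble may grow like `log n`) [cite: DuminilCopinPanis2025LowerBounds,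 Theorems 1.3 and 1.5 (pp. 5–6), Theorem 1.8 and Remark 1.9 (p. 7)]; the planners' lines already consume the strict window (route `LatticeSDPCertificates`, item `WindowBelowHalf`; card `top-heavy-bubble-nontriviality`, crux (1)) — on the barrier side this strictness is (modulo footnote 7) a necessity for every line, not a convenience of those; AUDIT 2026-08-16, generation 12 (`LongRangeTrivialityOnZ3LayeredAudit.lean`): the qualifying inputs listed above and isolated by generations 2–8 are NECESSARY, not sufficient — ON `ℤ³` the decoupled critical planes `J = 𝟙{|x-y|₁ = 1, x₃ = y₃}` (`layeredNNCoupling`: range one, reflection positive, `≤ J_nn`, light tail, `β_c = β_c(ℤ²) = ½ln(1+√2)`, in-plane `⟨σ₀σ_x⟩_{β_c} ≍ |x|^{-1/4}` [cite: ChelkakHonglerIzyurovAnnals2015, §1.2 (ϱ(δ) ∼ 𝒞₂δ^{1/4}), p. 4], hence `B(β_c) = ∞`, `χ_L(β_c) ≍ L^{7/4} ≫ L^{3/2}`, a top-heavy bubble, and planar `U₄ ≢ 0` [cite: AizenmanCDM2020, §6.3, eq. (6.7), pp. 22–23]) pass every one of them and have GAUSSIAN critical 3D smearings: `¬ HasNonGaussianSmearingZ3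 layeredNNCoupling`, PROVED (`not_hasNonGaussianSmearingZ3_layeredNN`, from `LayeredTrivialityOnZ3_holds` — partial flip symmetry kills all correlations across planes, Lebowitz–Griffiths `|U₄| ≤ 2⟨σσ⟩⟨σσ⟩` for a crossing pairing kills `U₄` unless the four points share a plane, so `∑_{Λ_{RL}⁴}|U₄| ≤ 2Σ_{RL}²/(2RL+1)`, and Aizenman's Proposition 12.1, smeared and summed for EVERY ferromagnet (`LongRangeIsing.mgfDeviation_le_ursellFourBoxSum`), gives `|⟨e^{zT_{f,L}}⟩ - e^{z²⟨T²_{f,L}⟩/2}| ≤ K_{f,z}/L`: the central limit theorem across independent layers) [cite: AizenmanCMP1982, Prop. 12.1, eq. (12.3)]; hence a nearest-neighbour proof must ALSO consume an input that fails for decoupled critical planes — irreducibility (A4) used quantitatively: the MMS2 comparison across axes, isotropy of the critical two-point function, a two-point lower bound in every lattice direction, or the vertical coupling `t` of `crossoverCoupling t` (`t = 1`: `J_nn`; `t = 0`: the planes; `not_vertical_uniform` — the mirror image of generation 7's `ε`-family: along `ε` the decisive input must be discontinuous at `0⁺`, along `t` it must vanish with the vertical coupling) [cite: Cardy1996, §3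 (Anisotropic scaling), pp. 58–59]; AUDIT 2026-08-16, generation 14 (`LongRangeTrivialityOnZ3IsothermAudit.lean`): every qualifying input recorded by generations 2–12 is a zero-field two-point statement or a structural one — the FIELD direction (`h > 0` at `β_c`) is untouched by all of them and carries a qualifying input of a new type, the in-field ONE-point ISOTHERM DEFICIT at the block-fluctuation field scale `h_L(z) = z/(β_c√Σ_L)`: '`|Λ_L|·m(β_c,h_L(z)) ≤ (1-c)·z√Σ_L/2` for some `z, c > 0` and infinitely many `L`' (`m(β,h) = ⟨σ₀⟩_{J,h,β}`; exponent form: the UPPER critical isotherm `m(β_c,h) = O(h^{1/δ_hyp})` with the hyperscaling value `δ_hyp = (5-η)/(1+η)` and `Σ_L ≥ cL^{5-η}` for the same `η`, implied by one-arm hyperscaling `⟨σ₀⟩⁺_{Λ_R;β_c} ≤ C⟨σ₀σ_{Re₁}⟩_{β_c}^{1/2}` through the GHS tangent line) — it is SUFFICIENT for block non-Gaussianity (`⟨e^{zM_L/√Σ_L}⟩_{β_c} ≤ e^{(1-c)z²/2}` at those `L`) by an interaction-uniform theorem valid for every translation-invariant ferromagnet `J ≥ 0` on `ℤ^d` (Griffiths'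 cap of the block moment generating function by the isotherm: block field `βh𝟙_{Λ_L} ≤` homogeneous field by Griffiths' comparison, plus Jensen in the tilted state, `LongRangeIsing.state_blockTilt_le_exp_mul`, `not_tendsto_mgfDeviation_of_isothermDeficit`; the `d`-dimensional free-state form of the first step of Camia–Garban–Newman's `1/15` paper, "`F(h) = ⟨M_L⟩_{β_c,h,+} = ∂_h log⟨e^{hM_L}⟩_{β_c,0,+}`, `F(h) ≤ F(0) + hF′(0)`" [cite: CamiaGarbanNewman2012, §2 (the display defining F(h) and eq. (2.2)), p. 4], whose planar output is "`log P(m > x) ∼ -cx^{16}` … an alternative proof that the field `Φ^∞` is non-Gaussian" [cite: CamiaGarbanNewman2016, Theorem 1.2 (i)–(ii), p. 2]), and it FAILS for every `α < 3/2` member, quantitatively: `(1-ε)z√Σ_L ≤ |Λ_L|m(β_c,h_L(z))` eventually for all `z, ε > 0` — the critical isotherm of the Gaussian members DOMINATES block linear response at the fluctuation scale (`IsothermDominanceOnZ3_holds`, PROVED from generation 10's block Gaussianity; `not_interactionUniformZ3_isothermDeficit`), in exponents their mean-field isotherm "`ch^{1/3} ≤ M(β_c,h) ≤ C′h^{1/3}`"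 [cite: AizenmanFernandez1988, Proposition 2.1 (b), eq. (2.10), p. 43] has `δ = 3 > δ_hyp = (3+α)/(3-α)` and over-responds by `L^{(3-2α)/3}`; status for `J_nn` on `ℤ³`: OPEN, and it is exactly the planners' residual — S6 'upper critical isotherm `m(β_c,h) ≤ Ah^{1/5}`' (at `η = 0`) of crux `CoulombImpliesNontrivial` (route `PerfectScreening`, line `SketchPub`, with `stub_isothermOfOneArm` and the Fisher-sharp converse `stub_lowerCriticalIsotherm`) and crux K1 of the card `flat-isotherm-subquadratic-mgf`; the rigorous one-sided information points the other way (`δ ≥ δ_hyp` [cite: Fisher1969], `M(β_c,h) ≥ ch^{1/3}` [cite: AizenmanBarskyFernandezJSP1987] — which with `Σ_L ≍ L^{5-η}` makes a deficit impossible unless `η ≤ 1/2`, generation 8's window from the field side), and above `d_c` the deficit fails for `J_nn` too (one-arm exponent `1`) [cite: HandaHeydenreichSakai2016] [cite: EngelenburgEtAl2025]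
- scope_caveats: (a) smeared averages `T_{f,L,β}` with the `Σ_L(β)` normalisation and the free-boundary infinite-volume state; the pointwise clause (iii) of the sub-problem (`Literature.Probability.LatticeModels.HasNontrivialU4` for `criticalCorr 3`, plus state) is not addressed literally; AUDIT 2026-08-15, generation 3 (`LongRangeTrivialityOnZ3PointwiseAudit.lean`): at the level of the connected four-point function the pointwise clause IS covered — for every `0 < α < 3/2` (more generally under the hypotheses of `BubbleTrivialityOnZ3`: `J ≥ 0` translation invariant, MMS2 at `β_c`, `B(β_c) < ∞`) every pointwise scaling limit `S` of the critical correlators `ρ(δ)ⁿ⟨∏σ_{[xᵢ/δ]}⟩_{β_c}` (`HasPointwiseScalingLimit`), for ANY renormalisation `ρ` and without non-degeneracy of `S₂`, has `U₄^S ≡ 0` on non-coincident configurations, hence `¬ HasNontrivialU4 S` (`LongRangeTrivialityOnZ3_pointwise`, `LongRangeIsing.limitConnectedFour_eq_zero_of_summable_sq`: tree diagram bound, the bubble tail by Cauchy–Schwarz, MMS2 beyond the bulk — the pointwise `β = β_c`, `δ → 0` form of "the bubble condition implies triviality" [cite: Panis2023Triviality, Remark 1.6 (p. 7) and Theorem 12.2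 (p. 51)], i.e. Aizenman's pointwise dimension count `|U₄|/S₄ ≤ C/L^{d-4+2η}`, here `3 - 2α > 0` [cite: AizenmanCDM2020, §10.1 eqs. (10.1)–(10.2), p. 31], made unconditional); the summit statement `CritIsing3DConformalLimit` with `criticalCorr 3` replaced by the member's correlators is false (`not_conformalLimitShape_algebraic`) and "some pointwise scaling limit has `U₄ ≢ 0`" is not interaction-uniform (`not_interactionUniformZ3_pointwiseU4`); what remains of (a): the free-boundary box-limit state versus the plus state of `criticalCorr 3` (equal at `β_c` for the nearest-neighbour model by continuity of the transition — cited, not bridged) and only `U₄`, not the higher cumulants, of a pointwise limit is addressed; (b) Theorem 1.2 is vendored with the constant's dependence on `f` absorbed (`C_f` for `C‖f‖_∞⁴ r_f^γ`) and for `0 < β ≤ β_c`; the variance footnote is vendored as an upper bound at `β_c` only; `β_c > 0` for `d ≥ 2` is vendored from the sentence citing Fisher 1967; all three were vendored as named facts — `panis_variance_bound` and `panis_criticalBeta_pos` are since proved (`…Proofs`, `…CriticalBeta`) and the formal barrier is proved from the infrared bound `panis_infraredBound_algebraic` alone (`LongRangeTrivialityOnZ3.of_irb`, `…TreeWick`: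 tree-graph Wick bound by random currents, tree diagram bound, MMS2, `χ_L ≤ C₂L^{-3}Σ_L`, all theorems); (c) the boundary case `α = 3/2` (`d_eff = 4`) is Gaussian too [cite: Panis2023Triviality, Corollary 1.11] but is printed through the renormalised coupling constant `g_σ(β) → 0`, not through the moment-generating-function bound, and is NOT part of the formal barrier (which covers `α < 3/2`); (d) the family `Z3Model` contains only the nearest-neighbour and the algebraically decaying couplings, so `InteractionUniformZ3` is narrower than "all (A1)–(A5) interactions" — enough for the no-go; (e) nothing is said about arguments using the actual decay of the nearest-neighbour two-point function or other inputs distinguishing `α ≥ 3/2` — SUPERSEDED by the audits: the qualifying inputs are catalogued under technique_class / evasions_known by generations 2–12 (two-point and structural) and generation 14 (the in-field isotherm deficit, `LongRangeTrivialityOnZ3IsothermAudit.lean`); (f) AUDIT 2026-08-15: the technique class is the EXTENSIONAL `InteractionUniformZ3` — an argument is blocked only if every one of its steps holds for some member with `α < 3/2`; the tools enumerated under technique_class are not blocked as such, since they accommodate nearest-neighbour-specific geometric steps (bonds crossing a mirror, the exponent `d - 2` of the nearest-neighbour infrared bound) and have produced the non-interaction-uniform output `B(β_c) = ∞` on `ℤ³`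 [cite: DuminilCopinPanis2025LowerBounds, Theorem 1.8]; (g) AUDIT 2026-08-15: the LOWER half of the variance footnote quoted in `panis_variance_bound` ("`0 < c_f ≤ ⟨T_{f,L,β}²⟩_β` for `f ≠ 0`") is false as a statement for all `L ≥ 1` — some `f ∈ C_c(ℝ^d)`, `f ≠ 0`, vanishes on `ℤ^d`, so `⟨T_{f,1,β}²⟩ = 0` (`LongRangeIsing.not_smeared_variance_lowerBound_literal`); it is to be read for `L ≥ L₀(f)` (and `β ≤ β_c`); only the upper half is vendored and used; AUDIT 2026-08-16, generation 11 (`LongRangeTrivialityOnZ3ProofsAudit.lean` §F): in that reading the lower half is a THEOREM for `f ≥ 0` — `∃ c_f > 0, L₀(f)` with `c_f ≤ ⟨T_{f,L,β}²⟩_{J,0,β}` for all `L ≥ L₀(f)`, EVERY ferromagnetic translation-invariant `J ≥ 0` on `ℤ^d` and EVERY `β ≥ 0` (`LongRangeIsing.exists_pos_le_state_smeared_sq_of_nonneg`: Griffiths I plus monotonicity and doubling of the block variance, `Σ_{NL} ≤ |Λ_N|²Σ_L`, `LongRangeIsing.blockVariance_mul_le`), which is the non-negative-`f` form printed by the source's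 predecessor ("for any non-negative continuous function `f ≢ 0` … `⟨T_{f,L}(σ)²⟩_β ≥ c_f > 0`, uniformly in `β ≤ β_c` and `L`") [cite: AizenmanDuminilCopinAnnals2021, §1 (display following Proposition 1.4), p. 6] — the audited footnote drops the sign condition; for SIGNED `f` the constant is NOT uniform in `β`: under long-range order `⟨σ₀σ_z⟩_{J,0,β} → κ > 0` (`|z| → ∞`) every odd `f ∈ C_c` has `⟨T²_{f,L,β}⟩_{J,0,β} → 0` (`LongRangeIsing.tendsto_state_smeared_sq_zero_of_odd_of_lro`), and at `β = β_c` it holds for the `α < 3/2` members by a spectral-measure / `p`-space infrared bound / bathtub argument recorded on paper in that file, not in print (the source proves neither half of the footnote and uses only `Σ_L(β)`) [cite: Panis2023Triviality, proof of Theorem 5.5 (definition of S(β,L,f)), p. 21]; consequently the common normalisation `Σ_L(β_c)^{1/2}` of `HasNonGaussianSmearingZ3` (Definition 1.1 of the source) loses nothing against self-normalised smearings `S_f/⟨S_f²⟩^{1/2}`, `S_f = ∑_x f(x/L)σ_x`, for the barrier's models — no evasion through the normalisation; AUDIT 2026-08-16, generation 16 (`LongRangeTrivialityOnZ3ProofsAudit.lean`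 §G): RANGE CORRECTION — that on-paper argument closes only for the members `0 < α < 1`, where its lower-bound step `Σ_L(β_c) ≥ cL^{3+α}` is printed ("The lower bound matches … for `α ∈ (0,1)`") [cite: Panis2023Triviality, Proposition 3.25 and Remark 3.26, p. 17]; for `1 ≤ α < 3/2` the printed critical two-point information on the members is `c|x|⁻² ≤ ⟨σ₀σ_x⟩_{β_c} ≤ C|x|^{α-3}` (`2 - α ≤ η ≤ 1`; a `(log|x|)⁻¹` below at `α = 1`) [cite: Panis2023Triviality, Proposition 3.25 (p. 17) and the display following Proposition 3.23 (p. 16)] together with the `p`-space cap `C|p|^{-α}` [cite: AizenmanFernandez1988, eq. (2.6), p. 42], positivity, positive-definiteness and the MMS inequalities, and these do NOT decide `c_f > 0` for a mean-zero `f` (§G3 there writes down a kernel with all of them along which `⟨T²_{f,L_k}⟩ → 0` for every smooth odd `f`, with `Σ_{L_k}` below `L_k^{3+α}` by a logarithm only); so for the members `1 < α < 3/2` (`α = 1` borderline) `c_f > 0` for SIGNED `f` at `β_c` — and with it Gaussianity of the SELF-normalised signed smearings `S_f/⟨S_f²⟩^{1/2}` — is OPEN, in substance the open lower bound `η ≤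 2 - α` (`Σ_L(β_c) ≍ L^{3+α}`) for the `ℓ¹` models (percolation analogue: matching lower bounds for `α < 1` only, and for `d > 3α` since [cite: Hutchcroft2025HighDim, Abstract]); 'no evasion through the normalisation' holds for `f ≥ 0` (every member, F1) and for all `f` when `α < 1`, which still keeps the self-normalised signed form of clause (iii) out of the extensional class (it fails for the member `α = 1/2`), but against such statements the demonstrated contrary range is `0 < α < 1`, not `0 < α < 3/2`; the formal barrier, Definition 1.1 and `HasNonGaussianSmearingZ3` (common normalisation `Σ_L(β_c)^{1/2}`, in which every `α < 3/2` member IS Gaussian, possibly degenerate on some signed `f`) are unaffected; AUDIT 2026-08-17, generation 26 (`LongRangeTrivialityOnZ3ProofsAudit.lean` §K): the source's author prints the lower half WITH the sign condition — "for positive functions `f` that are not identically zero, we have `0 < c_f ≤ ⟨T_{f,L,β}(σ)²⟩_β ≤ C_f < ∞`" [cite: GunaratnamPanis2025, Remark 1.3] — and strictly BELOW `β_c` nothing degenerates for any `f ≢ 0`, signed included: `T_{f,L,β}` converges to white noise, i.e. `⟨T²_{f,L,β}⟩ → 2^{-d}∫f² > 0` in Panis's normalisation [cite: GunaratnamPanis2025,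 Theorem 1.6 and Remark 1.7] (printed for the Euclidean kernels `C|x-y|₂^{-d-α}`, `d ≥ 2`, and for every translation-invariant ferromagnet with `⟨σ₀σ_x⟩_β ≤ C|x|^{-d-ε}` below `β_c` — for the `ℓ¹` members the Newman–Spohn/Aoun subcritical asymptotics `⟨σ₀σ_x⟩_β ∝ βχ(β)²J_{0,x}(1+o(1))` (`|x| → ∞`, `β < β_c` fixed) of their Proposition 1.1, printed for the Euclidean norm), so the possible degeneracy of signed smearings in the common normalisation is confined to `β ≥ β_c` ((F2) above `β_c`; AT `β_c` open for the members `1 ≤ α < 3/2` exactly as stated, re-examined without change in §K (K2)); (h) AUDIT 2026-08-15, generation 2: the parameter `α` enters the formal barrier only through `B(β_c) < ∞` — `LongRangeTrivialityOnZ3` is the corollary `BubbleTrivialityOnZ3.longRangeTrivialityOnZ3` of the sharpened barrier (`LongRangeTrivialityOnZ3BubbleAudit.lean`) and generation 1's `LongRangeIsing.summable_sq_pairCorrelation_criticalBeta`; the sharpened barrier also covers every member with `α ≥ 3/2`, and the nearest-neighbour coupling granted MMS2 for it in this formalisation, whose critical bubble would be finite — the property "finite critical bubble ⟹ Gaussian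 critical smearing" IS interaction-uniform on `Z3Model` (`interactionUniformZ3_bubble_triviality`), unlike "the critical bubble diverges" (`not_interactionUniformZ3_bubble_divergence`); (i) AUDIT 2026-08-15, generation 4 (`LongRangeTrivialityOnZ3SusceptibilityAudit.lean`): `α`, and the bubble itself, enter only through `χ_L(β_c)²/L³ → 0` — `LongRangeTrivialityOnZ3` and `BubbleTrivialityOnZ3` are the corollaries `SusceptibilityTrivialityOnZ3.longRangeTrivialityOnZ3` / `.bubbleTrivialityOnZ3` of the generation-4 barrier; "`χ_L(β_c) = o(L^{3/2})` ⟹ Gaussian critical smearing" IS interaction-uniform on `Z3Model` (`interactionUniformZ3_susceptibility_triviality`), MMS2 granted; the strictness of the enlargement over (h) is at the level of the two-point hypotheses (no member of `Z3Model` with `B(β_c) = ∞` and `χ_L(β_c) = o(L^{3/2})` is exhibited); (j) AUDIT 2026-08-15, generation 7 (`LongRangeTrivialityOnZ3PerturbativeAudit.lean`): the perturbed family `J_nn + ε|x-y|₁^{-3-α}` (`ε > 0`, `0 < α < 3/2`) is PROVED Gaussian at criticality (`PerturbativeTrivialityOnZ3_holds`, `LongRangeTrivialityOnZ3PerturbativeAuditProofs.lean`);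 the conjectural sharp threshold for perturbations of `J_nn` is `α = 3/2` (`𝔪_{3/2}`): for `3/2 < α < 2 - η_SR` a long-range non-Gaussian fixed point, for `α > 2 - η_SR` the short-range class [cite: PaulosEtAl2016, §1] [cite: Sak1973] — renormalisation-group predictions, not theorems; (k) AUDIT 2026-08-15, generation 8 (`LongRangeTrivialityOnZ3MarginalAudit.lean`): generation 5's window for the nearest-neighbour critical decay is to be read `0 < η < 1/2` STRICTLY — `η = 1/2` (marginal decay `⟨σ₀σ_x⟩_{β_c} = O(|x|^{-3/2})`, `HasCriticalDecay J (3/2)`) is the `ℤ⁴`-like line: the strict half "`θ > 3/2` ⟹ Gaussian" is a theorem and interaction-uniform (`interactionUniformZ3_marginalPrinciple_strict`), the endpoint is Gaussian for the member `α = 3/2` [cite: Panis2023Triviality, Corollary 1.11 (p. 8)] and conjecturally for every MMS-monotone reflection-positive `J` (`not_hasCriticalDecay_threeHalves_of_marginalPrinciple` carries the marginal principle as a hypothesis, never as a fact); (l) AUDIT 2026-08-15, generation 8: the generation-7 clause of technique_class "every argument containing a step that is upward-MONOTONE … or that survives all small such perturbations … is blocked" is to be read at the level of the CONCLUSION-BEARING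 property — `no_monotone_route` / `no_open_route` refute a property `Φ` of couplings that is upward-closed from `J_nn` (resp. `ℓ¹_s`-open at `J_nn`, `s < 3/2`) AND implies `HasNonGaussianSmearingZ3 J` for every `J` it holds at; an intermediate Griffiths comparison or continuity step inside an argument whose decisive input is discontinuous at `ε = 0` (as in the reflected-current proofs of Duminil-Copin–Panis, which use Griffiths' and the MMS inequalities throughout) is not blocked [cite: DuminilCopinPanis2025LowerBounds, §1.1 (strategy of proof of Theorem 1.2), p. 5]; (m) AUDIT 2026-08-16, generation 10 (`LongRangeTrivialityOnZ3BlockSpinAudit.lean`): BULK blocks of the infinite-volume state only — for the total magnetisation of the critical TORUS (periodic boundary conditions, block = system) a non-Gaussian quartic law is the mean-field rule, not the exception: Curie–Weiss `S_n/n^{3/4} → X` with density `∝ e^{-x⁴/12}` [cite: Ellis2006, Theorem V.9.5, p. 234]; hierarchical `|φ|⁴`, `d ≥ 4`, PBC: a non-Gaussian law `∝ e^{-¼|x|⁴-½s|x|²}` in a window containing the infinite-volume critical point, Gaussian with free boundary conditions [cite: MichtaParkSlade2023, §1.4 and Theorem 1.2]; nearest-neighbour Ising on `𝕋_r`, `d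 > 4`: the plateau and `0 < c_g ≤ g^{𝕋_r}(β_c - c₄r^{-d/2}) ≤ 2` for the renormalised coupling of the total magnetisation, "a non-Gaussian limit for the average field … in contrast to the situation at (and below) `β_c` with free boundary conditions … where the limit is Gaussian" [cite: LiuPanisSlade2025, Theorems 1.1 and 1.4, p. 4] — expected for the `α < 3/2` members as well; so a non-Gaussian law or `g^{torus} ≥ c > 0` for a torus-scale observable is neither blocked by this barrier nor an evasion of it nor evidence of non-triviality, and the link "torus law ⟷ bulk block law" is itself of the strength of clause (iii) (hyperscaling); (n) AUDIT 2026-08-16, generation 10: the formal target `HasNonGaussianSmearingZ3` quantifies over CONTINUOUS `f`, whereas the planners' block renormalised coupling `g_L = -U₄(M_L)/Σ_L² = 3 - ⟨(M_L/√Σ_L)⁴⟩` / block Binder cumulant concern the sharply cut `M_L = ∑_{x∈Λ_L}σ_x` (`f = 𝟙_{[-1,1]³} ∉ C_0(ℝ³)`, Panis's own normalising example); the loophole is closed — `LongRangeTrivialityOnZ3BlockSpin` (PROVED, `LongRangeTrivialityOnZ3BlockSpin_holds`): for every `C₀ > 0`, `0 < α < 3/2`, `|⟨e^{zM_L/√Σ_L}⟩_{β_c}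 - e^{z²/2}| ≤ K_z/L^{3-2α} → 0` and `⟨(M_L/√Σ_L)⁴⟩_{β_c} → 3` (`g_L → 0`), by the continuous envelopes `f_L` with `T_{f_L,L} = M_L/√Σ_L` and the `f`-uniform tree-graph Wick route (the printed proof of Theorem 5.5 uses `f` only through `‖f‖_∞` and `r_f`); "`liminf_L g_L > 0`" is not interaction-uniform (`not_interactionUniformZ3_blockSpin_fourthMoment`) [cite: Panis2023Triviality, Theorem 1.2 and proof of Theorem 5.5 (pp. 21–22)]; (o) AUDIT 2026-08-16, generation 12 (`LongRangeTrivialityOnZ3LayeredAudit.lean`): the layered models of that file are a THIRD triviality mechanism on `ℤ³` (independent layers, divergent tree diagram), outside `Z3Model` (they violate (A4)) and outside the hypotheses (MMS2) of `BubbleTrivialityOnZ3` / `SusceptibilityTrivialityOnZ3`, contradicting none of them; for them the smeared target `HasNonGaussianSmearingZ3` fails while the pointwise clause (iii) holds inside a plane (planar `U₄ ≢ 0`) — the smeared and pointwise forms of non-triviality part ways on reducible interactions (for the nearest-neighbour model they are expected equivalent), and nothing is claimed for the irreducible anisotropic couplings `crossoverCoupling t`, `t > 0`; (p) AUDIT 2026-08-16,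 generation 15 (`LongRangeTrivialityOnZ3IsotropyAudit.lean`): clause (ii) of the sub-problem (rotations, the unit inversion) is NOT TESTED by the contrary family — the `ℓ¹` kernels `|x-y|₁^{-3-α}` have the anisotropic `α`-stable symbol `E_J(k) ∼ |k|^α c_α(k̂)`, `c_α(k̂) ∝ ∫_{S²}|k̂·θ|^α|θ|₁^{-3-α}dσ(θ)` (at `α = 1`: `c₁(e₁) = 4/3 < c₁((e₁+e₂)/√2) = √2 < c₁((e₁+e₂+e₃)/√3) = 5√3/6`, a spread of `8 %`; numerically `5–8 %` for `α ∈ {1/2, 1, 1.4}`), so in the mean-field regime of the barrier the Gaussian limits of the members, which follow the Green function of the `J`-walk [cite: Panis2023Triviality, §1.2.1 (discussion following (A6′)), p. 7], are covariant under the hyperoctahedral group `B₃` and dilations but NOT under `O(3)`, hence not Möbius covariant (`not_isMoebiusCovariant_of_twoPoint_ne`) — expected, and printed for the percolation cousin: `ℓ¹` kernels "are not expected to yield rotationally-invariant scaling limits" [cite: Hutchcroft2025, Remark II.1.18, p. 18], the high-effective-dimension scaling limit being the `α`-stable superprocess whose Lévy measure has density `∝ ‖x‖^{-d-α}` in the MODEL's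 norm [cite: Hutchcroft2025HighDim, Theorem I.1.9 and Remark I.1.10, pp. 14–16]; so the contrary models (also generation 7's perturbed and generation 12's layered ones) witness '¬(ii) ∧ ¬(iii)' on `ℤ³`, not '(i) ∧ (ii) ∧ ¬(iii)', and the barrier is SILENT on arguments and route items of the shape '(ii) [full `O(3)`/Möbius covariance of the nearest-neighbour limit] + interaction-uniform steps ⟹ (iii)' or '(Möbius ∧ `U₄ ≡ 0`) ⟹ a two-point property of `J_nn`' (e.g. `GaussianLimitIsCoulomb`, `GaussianLimitNotScreened` of `Theses/PerfectScreening.lean`, `CovarianceUpgrade` of `Theses/MonotoneRG.lean`, `LimitsAreConformal` of `Theses/MirrorHoelderCompactness.lean`) — it must not be cited against them; what IS interaction-uniform is the lattice part of (ii): `B₃`-covariance of the free state for every observable, `β`, `h` and every member (`interactionUniformZ3_hyperoctahedral`), and the automatic isotropy of SECOND-order symbols of cubic-symmetric couplings (`LongRangeIsing.sum_box_mul_sq_inner_eq`; emergent rotational symmetry at the Gaussian level is a light-tail, `𝔪₂(J) < ∞`, phenomenon — the symmetry face of generation 7's tail separator — while `B₃` forces nothing at order `α < 2` or `4`, `quartic_cubicInvariant_not_isotropic`);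 the lattice models on `ℤ³` that DO witness '(i) ∧ (ii) ∧ ¬(iii)' — against which a (ii)-conditioned nearest-neighbour argument must be tested — are the SPREAD-OUT long-range Ising models with isotropic symbol (compound-zeta kernels), `0 < α < 3/2`, `L ≥ L₀`: critical two-point function `∼ (A/p_c)(γ_α/v_α)|x|₂^{α-3}` [cite: ChenSakai2015, Theorem 1.2] [cite: Sakai2020Crossover, Theorem 1.2, (2.5) and (2.8), pp. 52–54], whence, by the Gaussian pairing bound, Aizenman's deviation-from-Wick inequality with the tree diagram bound (relative size `L^{2α-3} → 0`) and uniqueness at `β_c` [cite: AizenmanCMP1982, Proposition 12.1] [cite: AizenmanDuminilCopinSidoravicius2015, Theorem 1.2], the pointwise limit of all `n`-point functions is the Möbius-covariant generalised free field of dimension `Δ = (3-α)/2` (`gffFamily`, `isMoebiusCovariant_gff`) — for which reflection positivity is not available and which are not in `Z3Model`, so a (ii)-conditioned argument for (iii) must consume reflection positivity / the transfer-matrix spectral representation, range one, or a quantitative `Δ_σ` near `1/2`; within reflection-positive models the Euclidean kernel `‖x-y‖₂^{-3-α}` (reflection positive on `ℤ³` as the restriction of the Osterwalder–Schrader-positive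 Riesz kernel `|x|^{-s}`, `s = 3+α ≥ d-2` — a derivation of that audit, the printed lists of examples being `ℓ¹` only [cite: Panis2023Triviality, §3.1 (examples (i)–(iv)), p. 13] [cite: AizenmanDuminilCopinSidoravicius2015, §1.4, p. 5]; Gaussian for `α < 3/2` by the general form of Theorem 1.2 [cite: Panis2023Triviality, Theorem 5.5 and Remark 5.4, p. 21]) is the candidate isotropic reflection-positive member, conditionally on its unproved critical two-point asymptotics (scalar amplitude); (q) AUDIT 2026-08-17, generation 23 (`LongRangeTrivialityOnZ3DiagonalRPAudit.lean`): the MIRROR axis of (A5) — the `ℓ¹` members are reflection positive through the coordinate mirrors only: the crossing kernel of `C₀|x-y|₁^{-3-α}` through the diagonal site-mirror `{x₀ = x₁}`, which in the coordinates `m = x₀+x₁`, `a = x₀-x₁ ≥ 1` reads `C₀(max(|m-m'|, a+a') + |x₂-y₂|)^{-s}`, `s = 3+α`, is NOT positive semidefinite on the strict half-space (three sites `(1,0,0), (2,1,0), (3,2,0)` with weights `(1,-1,1)` give `C₀(2·4^{-s} - 2^{-s}) < 0` for every `s > 1`: `LongRangeIsing.algebraicCoupling_diagonalCrossing_not_posSemidef`,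 all `α`; the `d = 2`, `α = 1` case was already in `…NoSlidingScale.lean`), whereas no nearest-neighbour bond joins the two strict sides of a diagonal site-mirror (`LongRangeIsing.nnCoupling_diagonalCrossing_eq_zero`; `J_nn` is reflection positive through all nine `B₃` mirror families) [cite: Biskup2009, §5.4 (Diagonal reflections)] [cite: FriedliVelenik2017, Lemma 10.8]; so `LongRangeIsing.DiagonalCrossingPSD m.coupling ↔ m = nearestNeighbour` on `Z3Model` (`Z3Model.diagonalCrossingPSD_iff`), and diagonal-mirror reflection positivity is a non-interaction-uniform STRUCTURAL input (`not_interactionUniformZ3_diagonalCrossingPSD`), formally unblocked, like range one (generation 5) and the light tail (generation 7); the source's example (ii) `Ce^{-μ|x-y|₁}` fails it as well (layer form `∝ e^{-2μa}cos(πa)tanh μ` in the transverse mode `e^{iπm/2}`), while the diagonal Messager–Miracle-Solé inequalities are unaffected (they need only `J_{x,y} ≥ J_{x,θy}` on one side; `panis_mms_two_point_monotone_holds`) [cite: Panis2023Triviality, Proposition 3.2, p. 13]; WHAT THE GAP PERMITS: (1) against clause (iii), nothing on paper — isotropic long-range kernels reflection positive through EVERY nearest-neighbour mirror exist: the Riesz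 kernel `‖x-y‖₂^{-3-α} = Γ(s-1)⁻¹∫₀^∞μ^{s-2}e^{-μ‖x-y‖}‖x-y‖⁻¹dμ` (a positive Yukawa mixture; `(-Δ_{ℝ³}+μ²)⁻¹` is reflection positive through every plane) [cite: GlimmJaffe1987, Theorems 7.10.1 and 6.2.2] and the fractional Laplacian `-((-Δ_{ℤ³})^{α/2})_{x≠y} = (sin(πα/2)/π)∫₀^∞u^{α/2}(-Δ+u)⁻¹_{x,y}du` (`LongRangePhi4.fracLaplacianZd`, a positive mixture of massive nearest-neighbour Green functions; the family of `Theses/LongRangeEndpoint.lean` above `α = 3/2`), both satisfying (A1)–(A5) with algebraic slices and hence having Gaussian critical smearings for `α < 3/2` by the general theorem [cite: Panis2023Triviality, Theorem 5.5 and Remark 5.4 (p. 21), §3.6 (p. 16)] — printed-theorem level, not formalised (no isotropic member in `Z3Model`; one run of `LongRangeTrivialityOnZ3.of_irb` for either kernel would close the certificate), so a diagonal-mirror argument for (iii) must still consume range one / the light tail or another catalogued qualifying input; these kernels are also the reflection-positive `(i) ∧ (ii) ∧ ¬(iii)` candidates of (p); (2) against clause (ii) — the nine mirrors of route `Theses/HyperoctahedralRP.lean`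 ('hyperoctahedral reflection positivity + one-variable analyticity ⟹ `O(3)`') — the barrier's family supplies NO counter-model (its anisotropic members lack the diagonal mirrors; the all-mirror kernels of (1) have leading-order isotropic symbols), and on paper no mixture `‖x‖₂^{-s} + t|x|₁^{-s}`, `t > 0`, is diagonally reflection positive either (transverse mode `e^{iπm/2}`: the `ℓ¹` layer form at distance `a` is `≈ 2(2a)^{-s}cos(πa)`, a power law with period-4 sign coming from the kink of `max`, against a Riesz form `O(a^pe^{-πa})`; numerically at `s = 4`, `a = 1…6`: `-8.5·10⁻², 6.5·10⁻³, -1.4·10⁻³, 4.6·10⁻⁴, -1.9·10⁻⁴, 9.3·10⁻⁵` versus `2.4·10⁻¹, 3.4·10⁻³, 8.0·10⁻⁵, 2.2·10⁻⁶, 6.8·10⁻⁸, 2.4·10⁻⁹`), i.e. `ℓ¹`-type anisotropy is exactly what the diagonal mirrors forbid; whether ANY translation-invariant ferromagnet on `ℤ³` with all nine mirrors and an anisotropic order-`|k|^α` symbol exists (it would be Gaussian for `α < 3/2` by (1), with a `B₃`- but not `O(3)`-covariant limit) is OPEN and is the decisive Gaussian test of that crux; the barrier must not be cited against 'nine mirrors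 ⟹ (ii)' items; (r) AUDIT 2026-08-17, generation 24 (`LongRangeTrivialityOnZ3ThermalAudit.lean`): the THERMAL sector — the susceptibility exponent `γ` (`β ↑ β_c`, `h = 0`), the specific heat, the energy operator `ε_x = σ_xσ_{x+e}` (the planners' route `Theses/EnergyNotSigmaSquared.lean`: `EnergyGapPowerLaw` '`⟨σ₀σ_{e₂};σ_xσ_{x+e₂}⟩_{β_c} ≤ C‖x‖^{-κ}⟨σ₀σ_x⟩²_{β_c}`, `κ > 0`', glossed there as `Δ_ε > 2Δ_σ ⟺ γ > 1` under scaling, `γ = (2y_h-d)/y_t = (d-2Δ_σ)/(d-Δ_ε)` with `Δ_ε = d - y_t` [cite: Cardy1996, §3.5 eq. (3.32) (p. 46) and §3.8 (x_E = d - y_t, p. 53)]) — is NOT constrained by the class: every contrary member, the marginal `α = 3/2` included, is mean-field in the thermal sector IN PRINT — "if a ferromagnetic Ising spin model has a reflection-positive pair interaction with a sufficiently slow decay, e.g. as `J_x = 1/|x|^{d+σ}` with `0 < σ ≤ d/2`, then the exponents `β̂, δ, γ` and `Δ₄` exist and take their mean-field values" [cite: AizenmanFernandez1988, Abstract and (1.2)–(1.3),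 p. 39], `C(β_c-β)⁻¹ ≤ χ ≤ C'(β_c-β)⁻¹|ln(β_c-β)|^μ` (`μ = 1` iff `d_eff = 4`) [cite: AizenmanFernandez1988, Proposition 2.1 (c) (2.11), p. 43], by Glimm–Jaffe's `∂χ/∂β ≤ |J|χ²` (GHS–Lebowitz), Sokal's `C_H ≤ |J|²B` and the Aizenman–Graham complement `∂(β|J|χ)/∂β ≥ c(β|J|χ)²/(1+(β|J|)²B)` [cite: AizenmanFernandez1988, §4 (4.5), (4.9), (4.10), pp. 47–48] with `B(β_c) < ∞` (`LongRangeIsing.summable_sq_pairCorrelation_criticalBeta`) — so '`γ > 1`', '`C_H = ∞`', '`Δ_ε > 2Δ_σ`' and `EnergyGapPowerLaw` are non-interaction-uniform, formally UNBLOCKED, and the barrier must not be cited against items conditioned on them (as for the (ii)-conditioned items of (p)); status for `J_nn` on `ℤ³`: OPEN (`γ ≥ 1` only); in random-current terms `-dχ⁻¹/dβ = (2d/χ²)∑_{x,y}⟨σ₀σ_x⟩⟨σ_{e₁}σ_y⟩𝐏^{0x,e₁y}_β[𝐂(0) ∩ 𝐂(e₁) = ∅]` is the averaged ADJACENT AVOIDANCE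 of two sourced currents with neighbouring sources [cite: Panis2025, §4.1], bounded below up to `β_c` for the members (finite bubble in (4.10)) and conjecturally `→ 0` for `J_nn`; the incipient infinite cluster of sourced random currents exists in every `d ≥ 3` with a near-critical formula [cite: Panis2025, Theorem 3.1], for `d > 4` `χ = A(1-β/β_c)⁻¹(1+o(1))` with `A⁻¹ = 2dβ_c·𝐏^{0∞,e₁∞}[𝐂(0) ∩ 𝐂(e₁) = ∅]` [cite: Panis2025, Theorems 1.3–1.4], and "`d = 4` is (just like for random walks) the critical dimension for the intersection of two neighbouring random current IICs" [cite: Panis2025, §1.4.2]; on paper (that audit, (L4)(c1)): for `J_nn` on `ℤ³`, a.s. intersection of the two neighbouring IICs implies `χ(β)(β_c-β) → ∞`; CAUTIONS: the POINTWISE failure of `EnergyGapPowerLaw` for the members (a lower bound `⟨σ₀σ_e;σ_xσ_{x+e}⟩_{β_c} ≥ c⟨σ₀σ_x⟩²`) is expected, not printed — only its thermodynamic shadow `γ = 1` is; the qualitative thermal statements (neighbouring IICs meet a.s., `χ(β)(β_c-β) → ∞`, `C_H → ∞`, like `B(β_c) = ∞`) are marginal-insensitive — expected on `ℤ⁴`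 and, with `μ = 1`, at `α = 3/2`, both Gaussian — so only the POWER forms (`γ' > 1` as an exponent, `κ > 0`) are of hyperscaling strength, and for the SMEARED clause (iii) even these need (A4) quantitatively: generation 12's decoupled critical planes satisfy the in-plane `EnergyGapPowerLaw` with `κ = 3/2` (planar `Δ_ε = 1` [cite: HonglerSmirnov2013, §1.2 (Theorem)], `Δ_σ = 1/8`) and have Gaussian 3D smearings; the interaction-uniform skeleton of the axis (fluctuation–dissipation `d⟨F⟩_{Λ,J,0,β}/dβ = ½∑J_{x,y}(⟨σ_xσ_yF⟩ - ⟨σ_xσ_y⟩⟨F⟩)`, Griffiths II for pair interactions, `d⟨σ_A⟩/dβ ≥ 0`) is proved in that audit file; (s) AUDIT 2026-08-17, generation 26 (`LongRangeTrivialityOnZ3ProofsAudit.lean` §K): the SURFACE / BOUNDARY-CONDITION sector — coercivity or shape-growth at `β_c` of the Duminil-Copin–Tassion sharpness functional `φ_S(β) = ∑_{x∈S,y∉S}tanh(βJ_{x,y})⟨σ₀σ_x⟩_{S,β,0}` (card `coercive-sharpness-boundary-amplification`: '`C_κ`: `φ_{β_c}(S) ≥ c·m^κ` for every finite `S ⊇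 Λ_m`', `κ > 0`, read there as the free-surface amplification exponent `1 - η_⊥`), free-wall / half-space exponents and responses, and wired-vs-free sensitivity of critical block observables (card `boundary-cannot-dictate-persistence`: a wired / `+` annulus left uncrossed with probability `≥ c` at every scale) — is NOT constrained by the class: for the members `0 < α < 1`, `1 ≤ φ_{β_c}(Λ_n) ≤ C` uniformly in `n` (lower bound: sharpness, whose proof "applies to infinite-range models" and gives "`φ_{β_c}(S) ≥ 1` for any finite set `S ∋ 0`" [cite: DuminilCopinTassionCMP2016, §1 and §2.2 (bullet preceding Proposition 2.2)]; upper bound, on paper in §K (K3): the infrared bound `panis_infraredBound_algebraic_holds`, Griffiths' `⟨σ₀σ_x⟩_{Λ_n,β_c,0} ≤ ⟨σ₀σ_x⟩_{β_c}`, `tanh t ≤ t`, `∑_{y∉Λ_n}|x-y|₁^{-3-α} ≤ C dist_∞(x,ℤ³∖Λ_n)^{-α}` and the lattice sum `∑_{m≤n}(24m²+2)m^{α-3}(n+1-m)^{-α} → 24B(α,1-α) + O(1)`, finite iff `α < 1`), so the members `α < 1` SATURATE sharpness at solid boxes, `C_κ` fails at `α = 1/2`, and coercivity is non-interaction-uniform,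 formally UNBLOCKED — the card's own prediction ("φ bounded for the trivial `α ≤ 3/2` models (a refuter's consistency check)") confirmed for `α < 1`; for `1 ≤ α < 3/2` only `φ_{β_c}(Λ_n) ≤ Cn^{α-1}` (`C log n` at `α = 1`) is proved, the boundary layer dominating the infinite-volume majorant, and boundedness is the calibration-level expectation (the free box kills the `J`-walk at its first jump out; the killed `α`-stable Green function heals like `(δ/n)^{α/2}` at the wall); and EVERY member crosses every annulus `Λ_{3L}∖Λ_L` by a single open FK edge with probability `≥ 1 - exp(-cβL^{3-α})` at any `β > 0` (the FK measure dominates Bernoulli percolation with edge parameters `p_e/(2-p_e)`, edgewise form of [cite: Grimmett2006, Theorem (3.21), (3.23), p. 43]; `∑_{x∈Λ_L,y∉Λ_{3L}}βJ_{x,y} ≍ L^{3-α} → ∞`), so annulus non-crossing and boundary-dictation levers fail KINEMATICALLY for all of them — unblocked too; CAUTIONS: for long-range `J` the functional `φ_{β_c}(Λ_n)` integrates the whole box against `dist(x,ℤ³∖Λ_n)^{-α}` (the Beta integrand `s^{α-1}(1-s)^{-α}`), so 'growth of `φ` = free-surface exponent' is a finite-range dictionary, and the members' free wall is soft (`δ^{α/2}`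 healing, not the harmonic `δ¹`) — the contrary family does not even pose the ordinary-transition question in the cards' form (`x ∼ y`); like (p)–(r), the barrier must not be cited against items conditioned on such inputs, and it supplies no evidence for them either; status for `J_nn` on `ℤ³`: OPEN (`κ_box ≈ 0.21` rests on surface-critical numerics, the `ε`-expansion and the boundary bootstrap — the card's own assessment); (t) AUDIT 2026-08-17, generation 28 (`LongRangeTrivialityOnZ3ProofsAudit.lean` §M): the SHAPE of the smeared block — the target, like Definition 1.1 of the source, names bulk profiles `f(x/L)` with one fixed `f ∈ C_c(ℝ³)` and the cube normalisation `Σ_L(β_c)`; block spins `M_A = ∑_{x∈A}σ_x` of coordinate boxes of diverging aspect ratio (slabs `Λ_L²×Λ_{h(L)}`, `h(L) = o(L)`; plaquettes `Λ_L²×{0}`; needles `Λ_L×{0}²`), planar / linear smearings `∑_{y∈ℤ²}g(y/L)σ_{(y,0)}/Σ_{P_L}^{1/2}` (`g ∈ C_c(ℝ²)`, `P_L = Λ_L²×{0}`) and block spins of lattice-thin curved supports (discrete spheres, circles), each self-normalised by `Σ_A = ⟨M_A²⟩_{β_c}`, are not of that form — and for generation 12's layered models planar and bulk smearings do part ways ((o)).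 No evasion: for every member `0 < α < 3/2` all of them are asymptotically GAUSSIAN at `β_c`, at the bulk rate — `Σ_A^{-2}∑_{x₁,…,x₄∈A}|U₄^{β_c}(x₁,…,x₄)| ≤ K|A|^{-(1-2α/3)}` for every coordinate box `A` of any side lengths and position (`= L^{-(3-2α)}` for cubes) and `≤ K(diam A)^{-(3-2α)}` for supports of uniformly regular density, whence `|⟨e^{zM_A/√Σ_A}⟩_{β_c} - e^{z²/2}| ≤ 32z⁴e^{z²/2}K|A|^{-(1-2α/3)}` and `⟨(M_A/√Σ_A)⁴⟩_{β_c} → 3` (on paper, §M (M2) there: the infrared bound `panis_infraredBound_algebraic_holds`, the tree diagram bound `panis_treeDiagramBound_holds`, the tree-graph Wick bound at arbitrary tuples `LongRangeIsing.abs_corr_sub_pairingSum_le`, and the Messager–Miracle-Solé inequalities in MIRROR form `LongRangeIsing.state_pair_axisRefl_le` (coordinate site and mid-edge planes) together with (MMS2) `panis_mms_two_point_monotone_holds`, through the shape-uniform row-sum bound `sup_u∑_{x∈A}⟨σ_uσ_x⟩_{β_c} ≤ 2³·3⁹·Σ_A/|A|` for coordinate boxes — its one-dimensional folding step PROVED,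 `LongRangeIsing.sum_Icc_le_three_mul_sum_Icc_of_mirror`: a nonnegative even `g` on `ℤ` with `g(t) ≤ g(k-t)` for `1 ≤ k < 2t` has `∑_{t∈I}g(t) ≤ 3∑_{|t|≤m}g(t)` on every window `I` of length `2m+1` — and its dyadic analogue for regular supports (the factor-3 dilation of (MMS2) costs a bounded index shift against geometrically growing shell counts); the argument is LOWER-BOUND-FREE, so the open flag of (g) for `1 ≤ α < 3/2` does not enter and the demonstrated contrary range is the full `0 < α < 3/2`; the planar covering and variance bounds are the audited file's `sum_sum_box_mul_le` / `state_smeared_sq_le` run in `d = 2` for the planar restriction of the two-point kernel) [cite: Panis2023Triviality, Theorem 1.2 (p. 6), Proposition 3.2 and Corollary 3.3 (p. 13)] [cite: AizenmanCMP1982, Prop. 12.1 and Prop. 5.3]; so 'some slab / plaquette / needle / planar / linear / spherical critical block spin has a non-Gaussian subsequential limit' is non-interaction-uniform exactly like the bulk target (false at `α = 1`) and is to be read as COVERED although `HasNonGaussianSmearingZ3` does not name it; supports without uniform density are rightly outside any such target (a block of boundedly many far clusters is non-Gaussian in every model, `κ₄(σ_x) = -2`, which is why Definition 1.1 smears against `f(x/L)`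 with `f` continuous); and under clause (ii) planarity is no restriction at the pointwise level either — any four points of `ℝ³` are Möbius-equivalent to four coplanar ones (invert about one point, then about a point of the plane through the three images), so `U₄ ≢ 0 ⟺ U₄ ≢ 0` on coplanar configurations for a Möbius-covariant limit, and planar reformulations of (iii) are (ii)-conditioned restatements in the sense of (p), not easier targets; (u) AUDIT 2026-08-17, generation 29 (`LongRangeTrivialityOnZ3ProofsAudit.lean` §N): the FK-CLUSTER sector — functionals of the Edwards–Sokal partition finer than spin correlations. With `S_k := ∑_C |C ∩ Λ_L|^k` over FK clusters, `⟨M_L²⟩ = E S₂` and `⟨M_L⁴⟩ = 3E S₂² - 2E S₄` [cite: SalasSokal2000, §3, Remark 1] (`q = 2`; fair-sign core PROVED there, `LongRangeIsing.sum_signVec_pow_four`), so `U₄(M_L) = 3Var S₂ - 2E S₄` and the spin sector certifies for the members only this COMBINATION (`= o(Σ_L²)`, caveat (n)); `E S₄ = ∑_{x,y,u,v∈Λ_L}P[x,y,u,v in one cluster]`, `Var S₂` and the largest-cluster share `max_C|C ∩ Λ_L|²/S₂` are connection statistics of ≥ 3 points, not spin correlations. ON EVERY FERROMAGNET (on paper,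 §N (N3): Lebowitz `U₄ ≤ 0`, Newman's `⟨M⁶⟩ ≤ 15⟨M²⟩³`, conditional Lindeberg, `log cos x ≤ -x²/2 - x⁴/12`): FRAGMENTATION (F) `S₄/S₂² → 0` in probability ⟺ [(G) Gaussian block law `M_L/√Σ_L ⇒ N(0,1)` ∧ (C) SELF-AVERAGING `S₂/E S₂ → 1`]; hence ¬(F) — a critical FK cluster keeping a fixed `L²`-share with non-vanishing probability infinitely often (crux (G1)/(GC) of the card `fk-giant-cluster-lindeberg`) — is a certified NECESSARY condition for (iii) in block form, interaction-uniformly; but (G) ALONE forces neither (F) nor (C): `N(0,1)` is the law of `bε + √(1-s)Z` with `b ~ |N(0,s)|`, `ε` a fair sign, `Z ~ N(0,1)` independent — an exactly Gaussian 'block spin' with a persistent random giant share and `Var(S₂/E S₂) = 2s² > 0` (the converse of Lindeberg–Feller needs a deterministic array). Consequently NEITHER (F) NOR (C) IS ESTABLISHED FOR ANY MEMBER of `Z3Model` (the card's calibration "for Panis's long-range models (F) holds" is the expectation, not a consequence of (n)): the lever ¬(F) is UNCALIBRATED against this barrier — not blocked (no member is known to satisfy it), not certified non-interaction-uniform either;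 its calibration item is (C) (equivalently (F), given (n)) for one member `α < 3/2`, an FK-covariance estimate `Var S₂ = ∑_{x,y,u,v∈Λ_L}Cov(𝟙{x↔y},𝟙{u↔v}) = o(Σ_L²)` at `β_c` that no spin-correlation bound supplies. CAUTION for FK-geometric levers at large (cluster-size tails, fractal dimension of critical FK clusters, number of macroscopic clusters, "FK clusters glue by long edges"): spin-Gaussianity does not make FK geometry mean-field — in the FK representation the nearest-neighbour model "simultaneously exhibits two upper critical dimensions (`d_c = 4`, `d_p = 6`)" with distinct geometric behaviour for `4 < d < 6` [cite: FangZhouDeng2022, Abstract] (numerics), and on `ℤ³` the contrary kernels `|x-y|₁^{-3-α}` have the spin threshold `α = 3/2` (`d_c = 2α`) against the Bernoulli-percolation threshold `α = 1` of the same kernel ("`d = min{6, 3α}`" [cite: Hutchcroft2025HighDim, Abstract]) — by that analogy (no theorem for `q = 2`) the Gaussian members `1 < α < 3/2` are expected to carry NON-mean-field critical FK geometry, so 'anomalous FK geometry ⟹ (iii)' finds no support in this barrier's family, and the one FK statistic certified to be tied to (iii) is the `L²`-share ¬(F), necessary and not known sufficient; the formal barrier is unaffected; (v) AUDIT 2026-08-17,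 generation 30 (`LongRangeTrivialityOnZ3MonotoneBlockingAudit.lean`): the BLOCKING sector — all-scale monotonicity in `L` of the blocking orbit of the critical state read in normalisation-free block moments, `ρ(L;k) = ⟨S_L(0)S_L(Lk)⟩/⟨S_L²⟩` (BM₂ = `MonotoneBlockingTwo` of route `Theses/MonotoneBlocking.lean`: `bc(L,k)·bc(L+1,0) ≤ bc(L+1,k)·bc(L,0)` for ALL `L ≥ 1` and all `k`, `bc(L,k) = ∑_{x,y∈[0,L)³}⟨σ₀σ_{Lk+x-y}⟩_{β_c}`; BM_mom; the spectral-smearing form SS of card `monotone-blocking`) is an EXISTENCE lever (the route imports clause (iii) as `LimitsAreConformal`; the barrier is not engaged and must not be cited against such items). Interaction-uniform skeleton (PROVED there; every ferromagnetic translation-invariant `J ≥ 0` on `ℤ^d`, every `β ≥ 0`): `ρ ∈ [0,1]` for every block and all offsets (`LongRangeIsing.sum_sum_image_add_state_le` / `…_nonneg`: positive semi-definiteness, translation invariance, Griffiths I), the per-site block variance `Σ_L/|Λ_L|` non-decreasing in `L` (`LongRangeIsing.blockVariance_div_card_mono`; so the card's dividend '`v` non-decreasing' needs no BM₂ and carries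 no information on criticality or the interaction), `1 ≤ Q₄(L) ≤ 3` ((n)); BM₂ proper is NOT uniform (false for every `β < β_c` beyond the correlation length, as the card says). CALIBRATION ON THE CONTRARY FAMILY, at the one level testable today — the Gaussian rungs (the massless Gaussian field with the `J`-walk Green function `G_α = (Ĵ(0) - Ĵ)⁻¹`, `J = |x-y|₁^{-3-α}`, which the member's critical two-point function is expected to follow [cite: Panis2023Triviality, §1.2.1 (discussion following (A6′)), p. 7]; the analogue of the card's lattice-GFF anchor, which the same computation reproduces: `ρ_GFF(L;e₁) = 0.34054, 0.44168, 0.47878, 0.49532, 0.50390`, Watson's `G(0) = 0.2527309`): BM₂ is FALSE at the rung of every member computed, `1/4 ≤ α ≤ 1.4` (torus-free quadrature of the exact lattice Green functions; `α = 1/4, 1/2`: `ρ(L;k)` DEcreasing from `L = 1` at every separated offset `|k|_∞ ≥ 2` — `α = 1/2`, `k = 2e₁`: `0.021526, 0.017868, 0.016783, 0.016282, 0.015991, 0.015799` — and from `L = 2–4` at the adjacent ones; `α = 3/4`: from `L = 1` on the axis offsets; `α = 0.9, 1, 1.1, 5/4, 1.4`: turnover at `L* = 3, 4, 4, 5–10,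 7–9`, the body-diagonal offsets first; `α = 1.49`: none through `L ≤ 8`; `J_nn`'s rung: none through `L ≤ 11`), through two lattice corrections of computed sign: the first correction to the `α`-stable symbol, `E_α(pê₁) = c_αp^α + a_αp² + …` with `a_α = (ζ(α-1) + 2ζ(α+1))/3 > 0` on all of `0 < α < 3/2` (the zeta-regularised second moment, via `∑_{|z|₁=n}|z|₂² = 2n⁴ + 4n²` and the polylogarithm expansion [cite: DLMF, §25.12, eq. 25.12.12]; confirmed to six digits), which depletes the self-block relative to the off-blocks and makes `ρ(L;k)` approach its limit FROM ABOVE at relative order `(a_α/c_α)(π/L)^{2-α}` — whence the failure for EVERY `α < 3/2` eventually: computed through `α = 1.4`, predicted for `1.4 < α < 3/2` beyond `L = 8` — against the on-site excess of the self-block (the card's 'nugget', relative order `L^{-α}`), nearest-neighbour-like at `α = 1.4` and ABSENT for small `α` (the lattice cuts off the `|x|^{α-3}` singularity of the continuum kernel), which sets the turnover scale; for `J_nn`'s rung both corrections push from below (`E_nn = |p|² - ∑ᵢpᵢ⁴/12 + …`: a negative first correction; a large on-site excess). CONSEQUENCES: BM₂ is non-interaction-uniform at rung level — formally UNBLOCKED,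 and the card's 'false for long-range members' is CORROBORATED, by a mechanism other than the one it names (no overshoot of `Q₄` is possible for the members, `Q₄(L) → 3` being its Lebowitz ceiling, (n)) — and it is irrelevant to clause (iii) in both directions (Theorem 1.2 makes every sub-sequential limit of a member Gaussian without convergence of any `ρ(L;k)` [cite: Panis2023Triviality, Theorem 1.2, p. 6]); at MEMBER level (the `β_c` states, not their rungs) BM₂ is undecided and undecidable from print (`⟨σ₀σ_k⟩_{β_c}` is unknown for every member; two-sided two-point bounds with unspecified constants, for `α < 1` only [cite: Panis2023Triviality, Proposition 3.25 and Remark 3.26, p. 17]; no member is known to have convergent `ρ(L;k)` at all, flag (G3) of (g)); CAUTION for the route (information, not a verdict on it): at the rungs the ALL-`L` inequality is decided by ultraviolet lattice data (the sign of the first symbol correction, the on-site excess), not by the fixed point, so it is expected to fail inside `J_nn`'s own universality class for interactions with the opposite ultraviolet signs (every perturbed kernel `J_nn + ε|x-y|₁^{-3-α}` of (j) is such: `E = εc_α|p|^α + (1 + εa_α)|p|² + …`), while the eventual version `∃L₀` — which already closes existence — depends only on the sign of the leading correction to scaling; routes `Theses/SynchronousCoupling.lean` and `Theses/ThresholdDilation.lean`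 (existence / covariance levers, (iii) imported) read the barrier correctly as not engaged; the formal barrier is unaffected; (w) AUDIT 2026-08-17, generation 42 (`LongRangeTrivialityOnZ3ProofsAuditLog.lean` §U): the MARKOV-INHERITANCE sector — passing the lattice Markov property (DLR with a conditioning collar of macroscopic thickness `ε`, exact for every range-one interaction at every mesh `δ < ε`) to the critical scaling limit, the bet of the cruxes `MarkovInheritance` (item 11236: `stub_collarMarkovBall`, `stub_collarMarkovHalfSpace`) and `GaussianLimitIsFree` (item 2601: `stub_sphereDecoupling_inheritance`; the lead's upper semicontinuity of collar-explained variance, `Cruxes/GaussianLimitIsFree/PICKED.md`) of `Theses/AnomalousForcesInteraction.lean` — is NOT engaged by this barrier (the contrary members are not finite range; the routes say so correctly) but IS calibrated by the finite-range contrary model of generation 12 (`layeredNNCoupling`, `LongRangeTrivialityOnZ3LayeredAudit.lean`: range one, reflection positive, Gaussian critical smearings `not_hasNonGaussianSmearingZ3_layeredNN`, violating only (A4)): its smeared critical limit — white noise in `x₃` with values in the planar Riesz (fractional Gaussian) field of order `7/4`, kernel `|u-v|^{-1/4}` [cite: ChelkakHonglerIzyurovAnnals2015, §1.2, p. 4]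 — violates Rozanov's collar Markov property [cite: Rozanov1982, Ch. 2 §1, (1.26)–(1.27)] at the unit ball at EVERY thickness `0 < ε < 1`, because the best linear prediction of an interior observable from the field on `{|x| > 1-ε}` is, slice by slice, the Riesz balayage of order `7/4` onto the exterior of a disc (Chen–Fukushima 2012, Theorem 3.4.2: energy-space projection = hitting distribution), which is spread over the WHOLE exterior with the Blumenthal–Getoor–Ray exit density `∝ (ρ²-|x|²)^{7/8}(|y|²-ρ²)^{-7/8}|x-y|^{-2}` (Kyprianou–Pardo 2022, Theorem 14.7: the stable process leaves the disc by a jump; for the GFF the exit law sits on the sphere) instead of in the collar; the `L²` decoupling form (D_ε) fails there for all small `ε`, and collar-explained variance is NOT upper semicontinuous along that lattice sequence ("the microscopic collar spins DO out-predict the smeared collar field": the planar screening is carried by non-linear functionals of the critical spins, erased by the central limit theorem across layers); so thick open-set conditioning does not by itself carry the Markov property to the limit, and every proof of those stubs for `J_nn` must spend an input failing for decoupled critical planes — the vertical coupling / (A4), a two-point lower bound along every lattice direction, or the isotropic non-degenerate form `A|x-y|^{-2Δ}` of the limit covariance (under which inheritance is already equivalent to `Δ = 1/2` by the landed `not_sphereDecoupling_of_ne_half`);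 nothing typed is refuted (the items are about `J_nn` and carry exactly such hypotheses) and the formal barrier is unaffected
- status: established (theorems [cite: Panis2023Triviality, Theorem 1.2, Corollary 1.11]; the formal barrier is PROVED UNCONDITIONALLY: `LongRangeTrivialityOnZ3_holds` in `LongRangeTrivialityOnZ3Holds.lean`, from `LongRangeTrivialityOnZ3.of_irb` (`…TreeWick.lean`) and the discharged infrared bound `panis_infraredBound_algebraic_holds` (`…InfraredBoundHolds.lean`, torus route: reflection positivity of the periodised power-law coupling, Gaussian domination on the even tori, vanishing of the torus zero mode below `β_c`, Griffiths' comparison); the original three-fact derivation `LongRangeTrivialityOnZ3.of_facts` is kept)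

[cite: Panis2023Triviality, Theorem 1.2 and §1.1] -/
def LongRangeTrivialityOnZ3 : Prop :=
  ∀ (C₀ α : ℝ), 0 < C₀ → 0 < α → α < 3 / 2 → ¬ HasNonGaussianSmearingZ3 (algebraicCoupling 3 C₀ α)

/-! ### Proof of the barrier from the named facts -/

/-- For `α < 3/2` on `ℤ³` the exponent `3 - 2(α ∧ 2) = 3 - 2α` is positive. [folklore] -/
theorem longRange_exponent_pos {α : ℝ} (hα' : α < 3 / 2) : 0 < ((3 : ℕ) : ℝ) - 2 * min α 2 := by
  rw [min_eq_left (by linarith : α ≤ 2)]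
  push_cast
  linarith

/-- **The barrier holds, granted Panis's Theorem 1.2, the variance footnote and `β_c > 0`.**
[cite: Panis2023Triviality, Theorem 1.2] -/
theorem LongRangeTrivialityOnZ3.of_facts (h12 : panis_thm12) (hvar : panis_variance_bound)
    (hβ : panis_criticalBeta_pos) : LongRangeTrivialityOnZ3 := by
  intro C₀ α hC₀ hα hα'
  rintro ⟨f, hf, hfs, z, hnot⟩
  apply hnot
  set J := algebraicCoupling 3 C₀ α with hJ
  have hexp := longRange_exponent_pos hα'
  obtain ⟨C, hC, hbound⟩ := h12 3 (by norm_num) C₀ α hC₀ hα hexp f hf hfs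
  have hβc : 0 < LongRangeIsing.criticalBeta J := hβ 3 (by norm_num) C₀ α hC₀ hα
  -- the variance bound for `|f|` (continuous, same support)
  have hfa : Continuous fun x => |f x| := hf.abs
  have hfas : HasCompactSupport fun x => |f x| := hfs.norm
  obtain ⟨Cf, hCf⟩ := hvar 3 (by norm_num) C₀ α hC₀ hα (fun x => |f x|) hfa hfas
  -- the majorant `K / L^{e}` with `e > 0`
  set K : ℝ := Real.exp (z ^ 2 / 2 * Cf) *
    (C * max (LongRangeIsing.criticalBeta J ^ (-(4 : ℝ))) (LongRangeIsing.criticalBeta J ^ (-(2 : ℝ))) * z ^ 4) with hK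
  have hmaj : ∀ L : ℕ, 1 ≤ L →
      mgfDeviation J (LongRangeIsing.criticalBeta J) L f z ≤ K * ((L : ℝ) ^ (((3 : ℕ) : ℝ) - 2 * min α 2))⁻¹ := by
    intro L hL
    have h1 := hbound (LongRangeIsing.criticalBeta J) hβc le_rfl L hL z
    have hCz : 0 ≤ C * max (LongRangeIsing.criticalBeta J ^ (-(4 : ℝ))) (LongRangeIsing.criticalBeta J ^ (-(2 : ℝ))) * z ^ 4 := by
      have : 0 ≤ max (LongRangeIsing.criticalBeta J ^ (-(4 : ℝ))) (LongRangeIsing.criticalBeta J ^ (-(2 : ℝ))) :=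
        le_max_of_le_left (Real.rpow_nonneg hβc.le _)
      positivity
    have hLpos : 0 < (L : ℝ) ^ (((3 : ℕ) : ℝ) - 2 * min α 2) := Real.rpow_pos_of_pos (by exact_mod_cast hL) _
    have h2 : Real.exp (z ^ 2 / 2 * state J (LongRangeIsing.criticalBeta J) 0
          (fun σ => smeared J (LongRangeIsing.criticalBeta J) L (fun x => |f x|) σ ^ 2)) ≤ Real.exp (z ^ 2 / 2 * Cf) := by
      apply Real.exp_le_exp.2
      exact mul_le_mul_of_nonneg_left (hCf L hL) (by positivity)
    calc mgfDeviation J (LongRangeIsing.criticalBeta J) L f z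
        ≤ Real.exp (z ^ 2 / 2 * state J (LongRangeIsing.criticalBeta J) 0
            (fun σ => smeared J (LongRangeIsing.criticalBeta J) L (fun x => |f x|) σ ^ 2)) *
            (C * max (LongRangeIsing.criticalBeta J ^ (-(4 : ℝ))) (LongRangeIsing.criticalBeta J ^ (-(2 : ℝ))) * z ^ 4 /
              (L : ℝ) ^ (((3 : ℕ) : ℝ) - 2 * min α 2)) := h1
      _ ≤ Real.exp (z ^ 2 / 2 * Cf) *
            (C * max (LongRangeIsing.criticalBeta J ^ (-(4 : ℝ))) (LongRangeIsing.criticalBeta J ^ (-(2 : ℝ))) * z ^ 4 /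
              (L : ℝ) ^ (((3 : ℕ) : ℝ) - 2 * min α 2)) :=
          mul_le_mul_of_nonneg_right h2 (div_nonneg hCz hLpos.le)
      _ = K * ((L : ℝ) ^ (((3 : ℕ) : ℝ) - 2 * min α 2))⁻¹ := by rw [hK]; ring
  -- the majorant tends to `0`
  have hlim : Tendsto (fun L : ℕ => K * ((L : ℝ) ^ (((3 : ℕ) : ℝ) - 2 * min α 2))⁻¹) atTop (𝓝 0) := by
    have h1 : Tendsto (fun L : ℕ => ((L : ℝ) ^ (((3 : ℕ) : ℝ) - 2 * min α 2))⁻¹) atTop (𝓝 0) :=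
      ((tendsto_rpow_atTop hexp).comp tendsto_natCast_atTop_atTop).inv_tendsto_atTop
    simpa using h1.const_mul K
  refine squeeze_zero' (Eventually.of_forall fun L => abs_nonneg _) ?_ hlim
  exact eventually_atTop.2 ⟨1, hmaj⟩

/-- **No interaction-uniform derivation of non-triviality on `ℤ³`:** the member `α = 1` (`C₀ = 1`)
of the family has Gaussian critical smearings. [cite: Panis2023Triviality, Theorem 1.2] -/
theorem LongRangeTrivialityOnZ3.not_interactionUniformZ3 (h : LongRangeTrivialityOnZ3) :
    ¬ InteractionUniformZ3 fun m => HasNonGaussianSmearingZ3 m.coupling :=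
  not_interactionUniformZ3_of_counterexample (.algebraic 1 1 one_pos one_pos)
    (h 1 1 one_pos one_pos (by norm_num))

/-- Quantitative form: within the family, a non-Gaussian critical smearing of an algebraically
decaying model forces `α ≥ 3/2`. [cite: Panis2023Triviality, Theorem 1.2] -/
theorem LongRangeTrivialityOnZ3.alpha_ge_of_hasNonGaussianSmearing (h : LongRangeTrivialityOnZ3)
    {C₀ α : ℝ} (hC₀ : 0 < C₀) (hα : 0 < α)
    (hng : HasNonGaussianSmearingZ3 (algebraicCoupling 3 C₀ α)) : 3 / 2 ≤ α := by
  by_contra hlt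
  exact h C₀ α hC₀ hα (lt_of_not_ge hlt) hng

/-- The same, phrased on the family: a member with a non-Gaussian critical smearing is the
nearest-neighbour model or has `α ≥ 3/2`. [cite: Panis2023Triviality, Theorem 1.2] -/
theorem LongRangeTrivialityOnZ3.nn_or_alpha_ge (h : LongRangeTrivialityOnZ3) (m : Z3Model)
    (hng : HasNonGaussianSmearingZ3 m.coupling) :
    m = .nearestNeighbour ∨ ∃ C₀ α hC₀ hα, m = .algebraic C₀ α hC₀ hα ∧ 3 / 2 ≤ α := by
  cases m with
  | nearestNeighbour => exact Or.inl rfl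
  | algebraic C₀ α hC₀ hα =>
    exact Or.inr ⟨C₀, α, hC₀, hα, rfl, h.alpha_ge_of_hasNonGaussianSmearing hC₀ hα hng⟩

end Literature.Barriers.CriticalPhenomena

end
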